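import Summits.AtomisticToContinuum.HydrodynamicLimit.Theses.TwoClocks
import Summits.AtomisticToContinuum.HydrodynamicLimit.Theorems.CorrectorPressureDecay.Negative.FreeFlow
import Summits.AtomisticToContinuum.HydrodynamicLimit.Theorems.CorrectorPressureDecay.Negative.Frame
import Summits.AtomisticToContinuum.HydrodynamicLimit.Theorems.TwoClocksEquilibriumShearWindowLDOneParticle
import Summits.AtomisticToContinuum.HydrodynamicLimit.Theorems.TwoClocksEquilibriumShearWindowLDCentring
import Summits.AtomisticToContinuum.HydrodynamicLimit.Theorems.TwoClocksEquilibriumShearWindowLD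
import Summits.AtomisticToContinuum.HydrodynamicLimit.Theorems.BoltzmannGreenKubo.Negative.MomentumWitness
import Literature.Analysis.FluidPDE.HardSphereMomentumConservation
import Literature.Analysis.FluidPDE.HardSphereTrajectoryMeasurable
import Literature.Probability.Distributions.GaussianCoordinateMoments
import Summits.AtomisticToContinuum.HydrodynamicLimit.Theorems.CorrectorPressureDecay.Negative.OrthEnergyTools

/-!
# Disproof of `EquilibriumFastWindowLD` (stmt-AtomisticToContinuum-14440) — findings of the standing disprover

Crux: `Summit.AtomisticToContinuum.HydrodynamicLimit.Theses.TwoClocks.EquilibriumFastWindowLD` ("KW at global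
equilibrium, fixed small density, general fast one-body functionals"; route TwoClocks, rank 2; the planner's
"fixed-density wall in its friendliest form"). Verdict so far: **NO KILL** — every cheap attack is absorbed by one of
the crux's own hypotheses, and for each such hypothesis the file proves (kernel-checked, `sorry`-free) that the crux
becomes FALSE when it is dropped. Everything conclusive is (being) landed under
`Theorems/EquilibriumFastWindowLD/Negative/` (same statements, namespace `…Theorems.EquilibriumFastWindowLDNegative`);
this work file restates them in the crux namespace so that it elaborates on its own.

## Read-back of the statement (probe `W.lean`, rc 0)

`∃σ₀>0 ∀a₀,θ₀>0 ∀u₀ ∀σ∈(0,σ₀) ∀Φ : Π N, HardSphereFlow 𝕋³ (σ(N+1)^{-1/3}) (N+1) ∀F : 𝕋³×ℝ³→ℝ` continuous,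
`|F(x,v)| ≤ C(1+‖v‖²)`, `∫F(x,·)M = ∫F(x,·)v_jM = ∫F(x,·)‖v‖²M = 0` at every `x` (`M = localMaxwellian 1 θ₀ u₀`, Lebesgue
`dv`; Bochner, junk-free because of the growth bound) `⇒ ∃β₀>0 ∀|β|≤β₀ ∀ε>0 ∃τ>0 ∃N₀ ∀N≥N₀:
∫⁻ exp(β Σᵢ w⁻¹∫₀ʷ F(Φ_r z i) dr) dG_N ≤ e^{ε(N+1)}`, `w = τ(N+1)^{-1/3}`, `G_N = localGibbsLaw σ a₀ u₀ θ₀ N (Φ N)`.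
No junk: `G_N` is a probability measure for `σ ≤ 1/2` (`isProbabilityMeasure_localGibbsLaw`), carried by the good set
(`localGibbsLaw_const_compl_good`), invariant (`measurePreserving_flow_localGibbsLaw_const`); the interval integral is
an honest integral on the good set (orbits are Borel in time, `IsHardSphereTrajectory.measurable_torus`; quadratic
growth + energy conservation bound it, `abs_window_integral_le`); `a₀` is decorative (canonical ensemble); the velocity
weight of `canonicalDensity ∘ localGibbsProfile` IS `localMaxwellian 1 θ₀ u₀`, so the three clauses centre `F` under the
true one-body marginal. Flows EXIST for `0 < σ < 1/2` (Alexander, `HardSphereFlow.nonempty_torus_holds`, proved in the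
tree), so `∀ Φ` is instantiable and every negative lemma below is UNCONDITIONAL.

## Findings (theorems of this file; (L) = landing proposal id)

(a) LOAD-BEARING HYPOTHESES — each dropped in turn, everything else verbatim:
* (a.0) `0 < σ` — `equilibriumFastWindowLD_false_at_zero : ¬ EquilibriumFastWindowLDAt 0` (L p114689). At `σ = 0` the
  free gas `freeFlow₀` is an inhabitant of the crux's flow type (`hsDiameter 0 N = 0`), velocities never change, the
  window average of the shear stress `v⁰v¹` is its initial value, and the moment is `((1-β²)^{-1/2})^{N+1} > e^{β²(N+1)/8}`
  at every window and every `N`. Any proof must use collisions, quantitatively in `τσ²√θ₀` (collisions per particle per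
  window): `Λ_τ` is neither continuous at `σ = 0⁺` for fixed `τ` nor uniform in `τ`.
* (a.1) `F ⊥ 1` — `equilibriumFastWindowLD_false_without_orthOne`. NOT the trivial "add a constant" (a constant is not
  `⊥ |v|²`): the witness `F = 5 − ‖v‖²` is `⊥ v_j`, `⊥ |v|²` (Wick `E‖v‖⁴ = 15`) with mean `2`; its window sum
  `5(N+1) − 2E(z)` is CONSERVED, moment `(e^{5β}(1+2β)^{-3/2})^{N+1} ≥ e^{2β(N+1)}` at every window.
* (a.2) `F ⊥ v_j` — `equilibriumFastWindowLD_false_without_orthMomentum`. Witness `F = v⁰` (⊥ 1, ⊥ |v|² by parity):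
  window sum = conserved momentum `P⁰`, moment `(e^{β²θ₀/2})^{N+1}` at every window (Galilean shells are exactly invariant).
* (a.3) `F ⊥ |v|²` — `equilibriumFastWindowLD_false_without_orthEnergy`. Witness `F = ‖v‖² − 3θ₀` (⊥ 1, ⊥ v_j): window sum
  `= 2E − 3(N+1)`, conserved; moment `(e^{-3β}(1-2β)^{-3/2})^{N+1} = e^{2ε(N+1)}`, `ε = ½(−3β − (3/2)log(1−2β)) > 0`
  (energy shells are exactly invariant; a temperature tilt is never relaxed).
* (a.4) continuity / quadratic growth of `F`: NOT load-bearing for falsity in the same way — they guarantee finiteness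
  (`|β| < 1/(4Cθ₀)`) and the Bochner integrals; dropping the growth bound makes the moment `+∞` at EVERY `β ≠ 0`
  (cubic kernel `setLIntegral_exp_cubic_eq_top` of `HighMomentumCutoffBarrierNarrow`; not re-proved here).
* (a.5) `∃ N₀` — load-bearing at `N = 0` (one sphere never collides): the provers' own
  `equilibriumShearWindowLD_forall_N_false` (`TwoClocksEquilibriumShearWindowLDOneParticle.lean`), imported verbatim.
* (a.6) `∃ β₀` (small tilt) — load-bearing and F-DEPENDENT: see (b.2).

(b) TIGHTNESS:
* (b.1) `Λ_τ(β) ≥ 0` always (Jensen, `one_le_lintegral_exp_windowSum` of the Centring file): the crux asserts exactly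
  `inf_τ limsup_N Λ = 0`; no negative rate.  `Λ_τ ≤ Λ_0 ≤ c(β)(N+1)` (Static file): averaging can only help.
* (b.2) β-CEILING — `windowMoment_FA_eq_top`, `two_mul_beta_mul_lt_one_of_windowMoment_ne_top` (file ready:
  `Negative/BetaCeiling.lean`): for every `A > 0` the ADMISSIBLE `F_A = A(‖v‖² − 15 + 12√2 e^{−v₀²/2})` (⊥ 1, v_j, |v|²
  all PROVED; `F_A ≥ A(‖v‖² − 15)`) has window moment `= +∞` for `βA ≥ ½` at EVERY `σ ≤ 1/2`, flow, window and `N`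
  (energy conservation + `∫e^{x²/2·2βA}dγ₁ = ∞`), so `β₀(F_A) < 1/(2A)`: `β₀` is F-dependent and must scale like `1/C_F`.
* (b.3) ENERGY-SHELL FLOOR — `shellFloor`, `beta_mul_mean_le_relEntropy_of_windowDecay` (file ready:
  `Negative/ShellFloor.lean`): for a velocity observable `g`, EVERY `θ > 0`, every `σ ≤ 1/2`, flow, window, `N`, `β`:
  `exp((N+1)[β ∫g dN(0,θ) − (3/2)(θ−1−log θ)]) ≤ ∫ exp(β Σᵢ w⁻¹∫₀ʷ g(vᵢ(r))dr) dG_N` (change of reference temperature —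
  the Gibbs law at `θ` has density `θ^{-3(N+1)/2}e^{-(1/θ−1)E}` w.r.t. the one at `1` — then Jensen under `G^{(θ)}`, whose
  window mean is static by invariance). Hence the crux's conclusion FORCES `β ∫g dN(0,θ) ≤ (3/2)(θ−1−log θ)` for all
  `θ > 0`, `|β| ≤ β₀`: the certified form of the "τ-independent β-ceiling from the quadratic EOS response",
  `β₀ ≤ β*_E(g) := inf_θ I(θ)/|m_θ(g)|` (finite and positive for admissible `g`).

(c) NATURAL STRENGTHENINGS refuted: `∀N` (a.5); `σ = 0` endpoint (a.0); uniform `β₀` — `equilibriumFastWindowLD_false_uniformBeta`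
(`∃β₀` moved in front of `∀F`; file ready `Negative/UniformBeta.lean`, witness `F_A`, `A = 1/(2β₀)`); each single
orthogonality clause is necessary (a.1–a.3), i.e. the admissible class cannot be enlarged within `span{1,v,|v|²}^⊥ᶜ`.

Landing status (2026-08-16, all ACCEPTED under `Theorems/EquilibriumFastWindowLD/Negative/`, namespace
`Summit.AtomisticToContinuum.HydrodynamicLimit.Theorems.EquilibriumFastWindowLDNegative`; import them rather than this file):
`ZeroDiameter.lean` p114689 (a.0) · `ConservedWindowSums.lean` p115074 (frame) · `WithoutOrthOne.lean` p117982 (a.1) ·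
`WithoutOrthMomentum.lean` p117979 (a.2) · `WithoutOrthEnergy.lean` p116557 (a.3) · `BetaCeiling.lean` p116570 (b.2) ·
`ShellFloor.lean` p116573 (b.3) · `UniformBeta.lean` p117986 (c.2). This work file restates the same theorems (same
proofs) in the crux namespace so that it elaborates stand-alone; a slim import-only edition is planned for cycle 2.
-/

noncomputable section

open MeasureTheory ProbabilityTheory Real Set
open scoped ENNReal

namespace Summit.AtomisticToContinuum.HydrodynamicLimit.Cruxes.EquilibriumFastWindowLD.Disproof

open Literature.Analysis.FluidPDE Literature.MathematicalPhysics.KineticTheory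
open Summit.AtomisticToContinuum.HydrodynamicLimit.Theorems
open Summit.AtomisticToContinuum.HydrodynamicLimit.Theorems.CorrectorPressureDecayNegative
open Summit.AtomisticToContinuum.HydrodynamicLimit.Theorems.CorrectorPressureDecayNegative.FreeFlow
  (freeFlow₀ freeFlow_flow hsDiameter_zero)

/-! ## (a.0) `0 < σ` is load-bearing: the free gas (to land as `Negative/ZeroDiameter.lean`, p114689) -/


/-- **The crux at a fixed reduced diameter `σ`.** `TwoClocks.EquilibriumFastWindowLD` with the prefix
`∃ σ₀ > 0, … ∀ σ, 0 < σ → σ < σ₀ →` removed and `σ` a parameter; every other token verbatim. A variant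
statement used to localise the load-bearing hypothesis `0 < σ`; not a fact. -/
def EquilibriumFastWindowLDAt (σ : ℝ) : Prop :=
  ∀ (a₀ θ₀ : ℝ) (u₀ : V3), 0 < a₀ → 0 < θ₀ →
    ∀ Φ : (N : ℕ) → HardSphereFlow (Torus.geometry (Fin 3)) (hsDiameter σ N) (N + 1),
    ∀ F : T3 × V3 → ℝ, Continuous F → (∃ C : ℝ, ∀ y, |F y| ≤ C * (1 + ‖y.2‖ ^ 2)) →
    (∀ x, ∫ v, F (x, v) * localMaxwellian 1 θ₀ u₀ v = 0) →
    (∀ x (j : Fin 3), ∫ v, F (x, v) * v j * localMaxwellian 1 θ₀ u₀ v = 0) →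
    (∀ x, ∫ v, F (x, v) * ‖v‖ ^ 2 * localMaxwellian 1 θ₀ u₀ v = 0) →
    ∃ β₀ : ℝ, 0 < β₀ ∧ ∀ β : ℝ, |β| ≤ β₀ → ∀ ε : ℝ, 0 < ε → ∃ τ : ℝ, 0 < τ ∧ ∃ N₀ : ℕ,
      ∀ N : ℕ, N₀ ≤ N →
        ∫⁻ z, ENNReal.ofReal (Real.exp (β * ∑ i : Fin (N + 1),
            (τ * ((N : ℝ) + 1) ^ (-(1 / 3 : ℝ)))⁻¹ *
              ∫ r in (0 : ℝ)..(τ * ((N : ℝ) + 1) ^ (-(1 / 3 : ℝ))), F (((Φ N).flow r z) i)))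
          ∂(localGibbsLaw σ (fun _ => a₀) (fun _ => u₀) (fun _ => θ₀) N (Φ N)) ≤
        ENNReal.ofReal (Real.exp (ε * ((N : ℝ) + 1)))

/-- The crux gives its fixed-diameter form at every `σ ∈ (0, σ₀)` (reordering of two universal
quantifiers; recorded so that `¬ EquilibriumFastWindowLDAt σ` for SOME small positive `σ` would refute
the crux, while `σ = 0` — refuted below — is exactly the excluded endpoint). [folklore] -/
theorem at_of_equilibriumFastWindowLD (h : Theses.TwoClocks.EquilibriumFastWindowLD) :
    ∃ σ₀ : ℝ, 0 < σ₀ ∧ ∀ σ : ℝ, 0 < σ → σ < σ₀ → EquilibriumFastWindowLDAt σ := by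
  obtain ⟨σ₀, hσ₀, H⟩ := h
  exact ⟨σ₀, hσ₀, fun σ hσ hσ' a₀ θ₀ u₀ ha hθ => H a₀ θ₀ u₀ ha hθ σ hσ hσ'⟩

/-- **Free flight freezes window averages of velocity observables**: under `freeFlow₀ N` (free flight,
diameter `0`) the window average over `(0, w]`, `w > 0`, of any `f(v_i)` is `f(v_i(0))`, for EVERY
datum `z` (no good-set restriction: the flow map is free flight everywhere). [folklore] -/
theorem windowAverage_freeFlow₀ (N : ℕ) (f : V3 → ℝ) (z : Config (N + 1) (Fin 3) T3)
    (i : Fin (N + 1)) {w : ℝ} (hw : 0 < w) :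
    w⁻¹ * ∫ r in (0 : ℝ)..w, f ((freeFlow₀ N).flow r z i).2 = f (z i).2 := by
  have h : ∫ r in (0 : ℝ)..w, f ((freeFlow₀ N).flow r z i).2 = ∫ _ in (0 : ℝ)..w, f (z i).2 := by
    refine intervalIntegral.integral_congr fun r _ => ?_
    show f ((freeFlow₀ N).flow r z i).2 = f (z i).2
    rw [freeFlow₀, freeFlow_flow, freeFlight_apply]
  rw [h, intervalIntegral.integral_const, sub_zero, smul_eq_mul, ← mul_assoc,
    inv_mul_cancel₀ hw.ne', one_mul]

/-- **Exact window exponential moment of the kinetic shear stress for the free gas**: at `σ = 0`,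
`a₀ > 0`, `θ₀ = 1`, `u₀ = 0`, for `β² < 1`, every `N` and every window `w > 0`,
`∫ exp(β Σᵢ w⁻¹∫₀ʷ vᵢ⁰(r)vᵢ¹(r) dr) dG_N = ((1 - β²)^{-1/2})^{N+1}` under the flow `freeFlow₀ N`
(velocities frozen; positions and velocities independent, velocities i.i.d. standard Gaussian under
the ideal-gas Gibbs law). [folklore] -/
theorem shearWindowMoment_freeFlow₀_eq {a₀ : ℝ} (ha : 0 < a₀) (N : ℕ) {β : ℝ} (hβ : β ^ 2 < 1)
    {w : ℝ} (hw : 0 < w) :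
    ∫⁻ z, ENNReal.ofReal (Real.exp (β * ∑ i : Fin (N + 1),
        w⁻¹ * ∫ r in (0 : ℝ)..w, (((freeFlow₀ N).flow r z i).2 0 * ((freeFlow₀ N).flow r z i).2 1)))
        ∂(localGibbsLaw 0 (fun _ => a₀) (fun _ => 0) (fun _ => 1) N (freeFlow₀ N)) =
      ENNReal.ofReal ((1 - β ^ 2) ^ (-(1 / 2 : ℝ))) ^ (N + 1) := by
  have hpt : ∀ z : Config (N + 1) (Fin 3) T3,
      β * ∑ i : Fin (N + 1), w⁻¹ * ∫ r in (0 : ℝ)..w,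
          (((freeFlow₀ N).flow r z i).2 0 * ((freeFlow₀ N).flow r z i).2 1) =
        ∑ i : Fin (N + 1), (fun v : V3 => β * (v 0 * v 1)) (z i).2 := by
    intro z
    rw [Finset.mul_sum]
    refine Finset.sum_congr rfl fun i _ => ?_
    rw [windowAverage_freeFlow₀ N (fun v : V3 => v 0 * v 1) z i hw]
  simp_rw [hpt]
  rw [localGibbsLaw_eq, lintegral_exp_sum_vel_localGibbsMeasure ha one_pos (0 : V3)
    (by norm_num : (0 : ℝ) ≤ 1 / 2) N (by fun_prop : Measurable fun v : V3 => β * (v 0 * v 1)),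
    lintegral_exp_mul_shear_gaussMeasure one_pos (by simpa using hβ)]
  simp

/-- **(a.0) Collisions are load-bearing: the crux FAILS at reduced diameter `σ = 0`.** Witness:
`a₀ = θ₀ = 1`, `u₀ = 0`, the free gas `freeFlow₀` (an inhabitant of the crux's flow type at `σ = 0`),
the kinetic shear stress `F(x,v) = v⁰v¹` (admissible: continuous, `|v⁰v¹| ≤ 1 + |v|²`, orthogonal to
`1, v_j, |v|²` under `M_{1,0,1}` by parity); for the `β₀` produced, `β := min β₀ ½`, `ε := β²/8`: at
whatever `τ, N₀` are offered, at `N = N₀` the window moment is `((1-β²)^{-1/2})^{N+1} > exp(β²(N+1)/8)`.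
[folklore] -/
theorem equilibriumFastWindowLD_false_at_zero : ¬ EquilibriumFastWindowLDAt 0 := by
  intro h
  set F : T3 × V3 → ℝ := fun y => (fun _ : T3 => (1 : ℝ)) y.1 * (y.2 0 * y.2 1) with hFdef
  obtain ⟨β₀, hβ₀, hβ⟩ := h 1 1 0 one_pos one_pos freeFlow₀ F
    (continuous_shearStress continuous_const) (exists_shear_growth_bound continuous_const)
    (fun x => integral_shear_mul_localMaxwellian 1 1)
    (fun x j => integral_shear_mul_vel_mul_localMaxwellian 1 1 j)
    (fun x => integral_shear_mul_norm_sq_mul_localMaxwellian 1 1)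
  -- a tilt in range
  set β : ℝ := min β₀ (1 / 2) with hβdef
  have hβpos : 0 < β := lt_min hβ₀ (by norm_num)
  have hβle : |β| ≤ β₀ := by
    rw [abs_of_pos hβpos]
    exact min_le_left _ _
  have hβhalf : β ≤ 1 / 2 := min_le_right _ _
  have hβsq : β ^ 2 ≤ 1 / 4 := by nlinarith
  have hβ1 : β ^ 2 < 1 := by linarith
  obtain ⟨τ, hτ, N₀, hN⟩ := hβ β hβle (β ^ 2 / 8) (by positivity)
  have h0 := hN N₀ le_rfl
  have hw : 0 < τ * ((N₀ : ℝ) + 1) ^ (-(1 / 3 : ℝ)) :=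
    mul_pos hτ (Real.rpow_pos_of_pos (by positivity) _)
  have hval := shearWindowMoment_freeFlow₀_eq one_pos N₀ hβ1 hw
  simp only [hFdef, one_mul] at h0
  rw [hval, ← ENNReal.ofReal_pow (Real.rpow_nonneg (by linarith) _),
    ENNReal.ofReal_le_ofReal_iff (Real.exp_pos _).le,
    show β ^ 2 / 8 * ((N₀ : ℝ) + 1) = ((N₀ : ℝ) + 1) * (β ^ 2 / 8) by ring] at h0
  have hnat : Real.exp (β ^ 2 / 8) ^ (N₀ + 1) < ((1 - β ^ 2) ^ (-(1 / 2 : ℝ))) ^ (N₀ + 1) :=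
    pow_lt_pow_left₀ (exp_div_eight_lt_rpow_neg_half (by positivity) hβsq) (Real.exp_pos _).le
      (Nat.succ_ne_zero N₀)
  have hcast : Real.exp (((N₀ : ℝ) + 1) * (β ^ 2 / 8)) = Real.exp (β ^ 2 / 8) ^ (N₀ + 1) := by
    rw [← Real.exp_nat_mul]; push_cast; ring_nf
  rw [hcast] at h0
  exact absurd h0 (not_le.2 hnat)


/-! ## Frame: conserved window sums and exact moments (to land as `Negative/ConservedWindowSums.lean`, p115074) -/


/-! ## Time integrability along good orbits -/

/-- A real observable of a good orbit, measurable and uniformly bounded in time, is interval integrable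
on every window (the orbit is Borel measurable in time, `IsHardSphereTrajectory.measurable_torus`).
[folklore] -/
theorem intervalIntegrable_comp_flow_of_abs_le {ε : ℝ} {n : ℕ}
    (Φ : HardSphereFlow (Torus.geometry (Fin 3)) ε n) {z : Config n (Fin 3) T3} (hz : z ∈ Φ.good)
    {H : Config n (Fin 3) T3 → ℝ} (hH : Measurable H) {C : ℝ} (hC : ∀ r, |H (Φ.flow r z)| ≤ C)
    (a b : ℝ) : IntervalIntegrable (fun r => H (Φ.flow r z)) volume a b := by
  have hm : Measurable fun r => H (Φ.flow r z) := hH.comp (Φ.isTrajectory z hz).measurable_torus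
  refine (intervalIntegrable_const (c := C)).mono_fun' hm.aestronglyMeasurable ?_
  exact ae_of_all _ fun r => by simpa [Real.norm_eq_abs] using hC r

/-- Speeds are bounded along a good orbit: `‖vᵢ(r)‖² ≤ 2E(z)`. [folklore] -/
theorem norm_vel_flow_sq_le {ε : ℝ} {n : ℕ} (Φ : HardSphereFlow (Torus.geometry (Fin 3)) ε n)
    {z : Config n (Fin 3) T3} (hz : z ∈ Φ.good) (r : ℝ) (i : Fin n) :
    ‖(Φ.flow r z i).2‖ ^ 2 ≤ 2 * configEnergy z := by
  have := norm_vel_sq_le_two_mul_configEnergy (Φ.flow r z) i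
  rwa [Φ.configEnergy_flow hz r] at this

/-- The squared speed of particle `i` is interval integrable along a good orbit. [folklore] -/
theorem intervalIntegrable_normSq_vel_flow {ε : ℝ} {n : ℕ}
    (Φ : HardSphereFlow (Torus.geometry (Fin 3)) ε n) {z : Config n (Fin 3) T3} (hz : z ∈ Φ.good)
    (i : Fin n) (a b : ℝ) :
    IntervalIntegrable (fun r => ‖(Φ.flow r z i).2‖ ^ 2) volume a b := by
  have hH : Measurable fun w : Config n (Fin 3) T3 => ‖(w i).2‖ ^ 2 :=
    ((measurable_pi_apply i).snd.norm).pow_const 2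
  refine intervalIntegrable_comp_flow_of_abs_le Φ hz hH (C := 2 * configEnergy z) (fun r => ?_) a b
  rw [abs_of_nonneg (sq_nonneg _)]
  exact norm_vel_flow_sq_le Φ hz r i

/-- A velocity component of particle `i` is interval integrable along a good orbit. [folklore] -/
theorem intervalIntegrable_coord_vel_flow {ε : ℝ} {n : ℕ}
    (Φ : HardSphereFlow (Torus.geometry (Fin 3)) ε n) {z : Config n (Fin 3) T3} (hz : z ∈ Φ.good)
    (i : Fin n) (k : Fin 3) (a b : ℝ) :
    IntervalIntegrable (fun r => (Φ.flow r z i).2 k) volume a b := by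
  have hH : Measurable fun w : Config n (Fin 3) T3 => (w i).2 k :=
    (EuclideanSpace.proj (𝕜 := ℝ) k).continuous.measurable.comp (measurable_pi_apply i).snd
  refine intervalIntegrable_comp_flow_of_abs_le Φ hz hH (C := 1 + 2 * configEnergy z) (fun r => ?_) a b
  have h1 : |(Φ.flow r z i).2 k| ≤ ‖(Φ.flow r z i).2‖ := by
    simpa [Real.norm_eq_abs] using PiLp.norm_apply_le (Φ.flow r z i).2 k
  have h2 : ‖(Φ.flow r z i).2‖ ≤ 1 + ‖(Φ.flow r z i).2‖ ^ 2 := by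
    nlinarith [norm_nonneg (Φ.flow r z i).2, sq_nonneg (‖(Φ.flow r z i).2‖ - 1)]
  exact h1.trans (h2.trans (by linarith [norm_vel_flow_sq_le Φ hz r i]))

/-! ## Conserved window sums -/

/-- **The window sum of the kinetic energies is conserved**: on the good set, for `w > 0`,
`Σᵢ w⁻¹∫₀ʷ ‖vᵢ(r)‖² dr = Σᵢ ‖vᵢ(0)‖²` (= `2E(z)`). [folklore] -/
theorem windowSum_normSq_eq {ε : ℝ} {n : ℕ} (Φ : HardSphereFlow (Torus.geometry (Fin 3)) ε n)
    {z : Config n (Fin 3) T3} (hz : z ∈ Φ.good) {w : ℝ} (hw : 0 < w) :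
    ∑ i, w⁻¹ * ∫ r in (0 : ℝ)..w, ‖(Φ.flow r z i).2‖ ^ 2 = ∑ i, ‖(z i).2‖ ^ 2 := by
  rw [← Finset.mul_sum, ← intervalIntegral.integral_finsetSum
    (fun i _ => intervalIntegrable_normSq_vel_flow Φ hz i 0 w)]
  have hconst : ∀ r, ∑ i, ‖(Φ.flow r z i).2‖ ^ 2 = 2 * configEnergy z := by
    intro r
    rw [← Φ.configEnergy_flow hz r, configEnergy]
    ring
  have hz0 : ∑ i, ‖(z i).2‖ ^ 2 = 2 * configEnergy z := by rw [configEnergy]; ring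
  simp_rw [hconst]
  rw [intervalIntegral.integral_const, sub_zero, smul_eq_mul, ← mul_assoc, inv_mul_cancel₀ hw.ne',
    one_mul, hz0]

/-- **Affine functions of the kinetic energy have conserved window sums**: on the good set, for `w > 0`,
`Σᵢ w⁻¹∫₀ʷ (a + b‖vᵢ(r)‖²) dr = Σᵢ (a + b‖vᵢ(0)‖²)`. [folklore] -/
theorem windowSum_affine_normSq_eq {ε : ℝ} {n : ℕ} (Φ : HardSphereFlow (Torus.geometry (Fin 3)) ε n)
    {z : Config n (Fin 3) T3} (hz : z ∈ Φ.good) (a b : ℝ) {w : ℝ} (hw : 0 < w) :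
    ∑ i, w⁻¹ * ∫ r in (0 : ℝ)..w, (a + b * ‖(Φ.flow r z i).2‖ ^ 2) = ∑ i, (a + b * ‖(z i).2‖ ^ 2) := by
  have hsplit : ∀ i, w⁻¹ * ∫ r in (0 : ℝ)..w, (a + b * ‖(Φ.flow r z i).2‖ ^ 2) =
      a + b * (w⁻¹ * ∫ r in (0 : ℝ)..w, ‖(Φ.flow r z i).2‖ ^ 2) := by
    intro i
    have hI := intervalIntegrable_normSq_vel_flow Φ hz i 0 w
    rw [intervalIntegral.integral_add intervalIntegrable_const (hI.const_mul b),
      intervalIntegral.integral_const, intervalIntegral.integral_const_mul, sub_zero, smul_eq_mul,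
      mul_add, ← mul_assoc, inv_mul_cancel₀ hw.ne', one_mul]
    ring
  calc ∑ i, w⁻¹ * ∫ r in (0 : ℝ)..w, (a + b * ‖(Φ.flow r z i).2‖ ^ 2)
      = ∑ i, (a + b * (w⁻¹ * ∫ r in (0 : ℝ)..w, ‖(Φ.flow r z i).2‖ ^ 2)) := Finset.sum_congr rfl fun i _ => hsplit i
    _ = ∑ _i : Fin n, a + b * ∑ i, w⁻¹ * ∫ r in (0 : ℝ)..w, ‖(Φ.flow r z i).2‖ ^ 2 := by
        rw [Finset.sum_add_distrib, Finset.mul_sum]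
    _ = ∑ _i : Fin n, a + b * ∑ i, ‖(z i).2‖ ^ 2 := by rw [windowSum_normSq_eq Φ hz hw]
    _ = ∑ i, (a + b * ‖(z i).2‖ ^ 2) := by rw [Finset.sum_add_distrib, Finset.mul_sum]

/-- **The window sum of a momentum component is conserved**: on the good set, for `w > 0`,
`Σᵢ w⁻¹∫₀ʷ vᵢᵏ(r) dr = Σᵢ vᵢᵏ(0)`. [folklore] -/
theorem windowSum_coord_eq {ε : ℝ} {n : ℕ} (Φ : HardSphereFlow (Torus.geometry (Fin 3)) ε n)
    {z : Config n (Fin 3) T3} (hz : z ∈ Φ.good) (k : Fin 3) {w : ℝ} (hw : 0 < w) :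
    ∑ i, w⁻¹ * ∫ r in (0 : ℝ)..w, (Φ.flow r z i).2 k = ∑ i, (z i).2 k := by
  rw [← Finset.mul_sum, ← intervalIntegral.integral_finsetSum
    (fun i _ => intervalIntegrable_coord_vel_flow Φ hz i k 0 w)]
  have hconst : ∀ r, ∑ i, (Φ.flow r z i).2 k = ∑ i, (z i).2 k := by
    intro r
    have h := congrArg (fun p : V3 => p k) (Φ.configMomentum_flow hz r)
    simpa [configMomentum] using h
  simp_rw [hconst]
  rw [intervalIntegral.integral_const, sub_zero, smul_eq_mul, ← mul_assoc, inv_mul_cancel₀ hw.ne',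
    one_mul]

/-! ## Gaussian values on `ℝ³` -/

/-- **Linear exponential moment of a coordinate**: `∫ e^{t wₖ} dγ₃(w) = e^{t²/2}` (coordinate marginal
`BoltzmannGreenKuboOrthMomentum.measurePreserving_coord` + the real Gaussian mgf). [folklore] -/
theorem lintegral_exp_mul_coord_stdGaussian (t : ℝ) (k : Fin 3) :
    ∫⁻ w, ENNReal.ofReal (Real.exp (t * w k)) ∂(stdGaussian V3) = ENNReal.ofReal (Real.exp (t ^ 2 / 2)) := by
  have hf : Measurable fun x : ℝ => ENNReal.ofReal (Real.exp (t * x)) := by fun_prop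
  rw [← lintegral_exp_mul_gaussianReal t]
  exact (BoltzmannGreenKuboOrthMomentum.measurePreserving_coord k).lintegral_comp hf

/-- **Quadratic exponential moment of the speed**: for `2s < 1`, `∫ e^{s‖w‖²} dγ₃(w) = ((1-2s)^{-1/2})³`
(independent coordinates, `lintegral_exp_mul_sq_gaussianReal` in each). [folklore] -/
theorem lintegral_exp_mul_normSq_stdGaussian {s : ℝ} (hs : 2 * s < 1) :
    ∫⁻ w, ENNReal.ofReal (Real.exp (s * ‖w‖ ^ 2)) ∂(stdGaussian V3) =
      ENNReal.ofReal ((1 - 2 * s) ^ (-(1 / 2 : ℝ))) ^ 3 := by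
  set μ : Fin 3 → Measure ℝ := fun _ => gaussianReal 0 1 with hμ
  have hGm : Measurable fun w : V3 => ENNReal.ofReal (Real.exp (s * ‖w‖ ^ 2)) := by fun_prop
  have h1 : ∫⁻ w, ENNReal.ofReal (Real.exp (s * ‖w‖ ^ 2)) ∂(stdGaussian V3) =
      ∫⁻ x, ENNReal.ofReal (Real.exp (s * ‖(WithLp.toLp 2 x : V3)‖ ^ 2)) ∂(Measure.pi μ) := by
    rw [hμ, ← map_pi_eq_stdGaussian, lintegral_map hGm (PiLp.continuous_toLp 2 _).measurable]
  rw [h1]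
  have h2 : ∀ x : Fin 3 → ℝ, ENNReal.ofReal (Real.exp (s * ‖(WithLp.toLp 2 x : V3)‖ ^ 2)) =
      ∏ k : Fin 3, ENNReal.ofReal (Real.exp (s * x k ^ 2)) := by
    intro x
    rw [EuclideanSpace.real_norm_sq_eq, Finset.mul_sum, Real.exp_sum,
      ENNReal.ofReal_prod_of_nonneg fun k _ => (Real.exp_pos _).le]
  simp_rw [h2]
  rw [show (∫⁻ x : Fin 3 → ℝ, ∏ k : Fin 3, ENNReal.ofReal (Real.exp (s * x k ^ 2)) ∂(Measure.pi μ)) =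
      ∫⁻ x : Fin 3 → ℝ, ∏ k : Fin 3, (fun (_ : Fin 3) (y : ℝ) => ENNReal.ofReal (Real.exp (s * y ^ 2))) k (x k)
        ∂(Measure.pi μ) from rfl,
    lintegral_fintype_prod_eq_prod' (f := fun (_ : Fin 3) (y : ℝ) => ENNReal.ofReal (Real.exp (s * y ^ 2))) μ
      (fun _ => by fun_prop)]
  simp only [hμ, Finset.prod_const, Finset.card_univ, Fintype.card_fin]
  rw [lintegral_exp_mul_sq_gaussianReal hs]

/-! ## Exact window moments under the global Gibbs law at rest (`θ₀ = 1`) -/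

/-- **Exact window exponential moment of `F = a + b‖v‖²`** (any `σ ≤ 1/2`, any flow, any window `w > 0`,
`a₀ > 0`, `θ₀ = 1`, `u₀ = 0`, `2βb < 1`):
`∫ exp(β Σᵢ w⁻¹∫₀ʷ (a + b‖vᵢ(r)‖²) dr) dG_N = (e^{βa} ((1-2βb)^{-1/2})³)^{N+1}`. The window sum is
conserved, so the moment is the static one-body product. [folklore] -/
theorem windowMoment_affine_normSq_eq {a₀ : ℝ} (ha : 0 < a₀) {σ : ℝ} (hσ2 : σ ≤ 1 / 2) (N : ℕ)
    (Φ : HardSphereFlow (Torus.geometry (Fin 3)) (hsDiameter σ N) (N + 1)) (a b : ℝ) {β : ℝ}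
    (hβb : 2 * (β * b) < 1) {w : ℝ} (hw : 0 < w) :
    ∫⁻ z, ENNReal.ofReal (Real.exp (β * ∑ i : Fin (N + 1),
        w⁻¹ * ∫ r in (0 : ℝ)..w, (a + b * ‖(Φ.flow r z i).2‖ ^ 2)))
        ∂(localGibbsLaw σ (fun _ => a₀) (fun _ => 0) (fun _ => 1) N Φ) =
      (ENNReal.ofReal (Real.exp (β * a)) * ENNReal.ofReal ((1 - 2 * (β * b)) ^ (-(1 / 2 : ℝ))) ^ 3) ^
        (N + 1) := by
  have hae : ∀ᵐ z ∂(localGibbsLaw σ (fun _ => a₀) (fun _ => 0) (fun _ => 1) N Φ), z ∈ Φ.good :=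
    mem_ae_iff.2 (localGibbsLaw_const_compl_good σ a₀ 1 0 N Φ)
  have hcongr : ∫⁻ z, ENNReal.ofReal (Real.exp (β * ∑ i : Fin (N + 1),
        w⁻¹ * ∫ r in (0 : ℝ)..w, (a + b * ‖(Φ.flow r z i).2‖ ^ 2)))
        ∂(localGibbsLaw σ (fun _ => a₀) (fun _ => 0) (fun _ => 1) N Φ) =
      ∫⁻ z, ENNReal.ofReal (Real.exp (∑ i : Fin (N + 1), (fun v : V3 => β * (a + b * ‖v‖ ^ 2)) (z i).2))
        ∂(localGibbsLaw σ (fun _ => a₀) (fun _ => 0) (fun _ => 1) N Φ) := by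
    refine lintegral_congr_ae ?_
    filter_upwards [hae] with z hz
    rw [windowSum_affine_normSq_eq Φ hz a b hw, Finset.mul_sum]
  rw [hcongr, localGibbsLaw_eq, lintegral_exp_sum_vel_localGibbsMeasure ha one_pos (0 : V3) hσ2 N
    (by fun_prop : Measurable fun v : V3 => β * (a + b * ‖v‖ ^ 2)), gaussMeasure_zero_one]
  congr 1
  have hpt : ∀ w' : V3, ENNReal.ofReal (Real.exp (β * (a + b * ‖w'‖ ^ 2))) =
      ENNReal.ofReal (Real.exp (β * a)) * ENNReal.ofReal (Real.exp ((β * b) * ‖w'‖ ^ 2)) := by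
    intro w'
    rw [← ENNReal.ofReal_mul (Real.exp_pos _).le, ← Real.exp_add]
    congr 2
    ring
  simp_rw [hpt]
  rw [lintegral_const_mul _ (by fun_prop), lintegral_exp_mul_normSq_stdGaussian hβb]

/-- **Exact window exponential moment of a velocity component `F = vₖ`** (any `σ ≤ 1/2`, any flow, any
window `w > 0`, `a₀ > 0`, `θ₀ = 1`, `u₀ = 0`): `∫ exp(β Σᵢ w⁻¹∫₀ʷ vᵢᵏ(r) dr) dG_N = (e^{β²/2})^{N+1}`
(the window sum is the conserved momentum). [folklore] -/
theorem windowMoment_coord_eq {a₀ : ℝ} (ha : 0 < a₀) {σ : ℝ} (hσ2 : σ ≤ 1 / 2) (N : ℕ)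
    (Φ : HardSphereFlow (Torus.geometry (Fin 3)) (hsDiameter σ N) (N + 1)) (k : Fin 3) (β : ℝ)
    {w : ℝ} (hw : 0 < w) :
    ∫⁻ z, ENNReal.ofReal (Real.exp (β * ∑ i : Fin (N + 1), w⁻¹ * ∫ r in (0 : ℝ)..w, (Φ.flow r z i).2 k))
        ∂(localGibbsLaw σ (fun _ => a₀) (fun _ => 0) (fun _ => 1) N Φ) =
      ENNReal.ofReal (Real.exp (β ^ 2 / 2)) ^ (N + 1) := by
  have hae : ∀ᵐ z ∂(localGibbsLaw σ (fun _ => a₀) (fun _ => 0) (fun _ => 1) N Φ), z ∈ Φ.good :=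
    mem_ae_iff.2 (localGibbsLaw_const_compl_good σ a₀ 1 0 N Φ)
  have hcongr : ∫⁻ z, ENNReal.ofReal (Real.exp (β * ∑ i : Fin (N + 1),
        w⁻¹ * ∫ r in (0 : ℝ)..w, (Φ.flow r z i).2 k))
        ∂(localGibbsLaw σ (fun _ => a₀) (fun _ => 0) (fun _ => 1) N Φ) =
      ∫⁻ z, ENNReal.ofReal (Real.exp (∑ i : Fin (N + 1), (fun v : V3 => β * v k) (z i).2))
        ∂(localGibbsLaw σ (fun _ => a₀) (fun _ => 0) (fun _ => 1) N Φ) := by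
    refine lintegral_congr_ae ?_
    filter_upwards [hae] with z hz
    rw [windowSum_coord_eq Φ hz k hw, Finset.mul_sum]
  rw [hcongr, localGibbsLaw_eq, lintegral_exp_sum_vel_localGibbsMeasure ha one_pos (0 : V3) hσ2 N
    (by fun_prop : Measurable fun v : V3 => β * v k), gaussMeasure_zero_one,
    lintegral_exp_mul_coord_stdGaussian β k]

/-! ## Admissibility integrals against the Maxwellian `M_{1,0,1}` -/

/-- Integrals against `M_{1,0,1}(v) dv` are standard-Gaussian integrals. [folklore] -/
theorem integral_mul_localMaxwellian_one_zero (g : V3 → ℝ) :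
    ∫ v, g v * localMaxwellian 1 1 (0 : V3) v = ∫ w, g w ∂stdGaussian V3 := by
  have h := integral_localMaxwellian_smul (E := V3) one_pos (0 : V3) g
  simp only [smul_eq_mul, Real.sqrt_one, one_smul, zero_add] at h
  simp_rw [mul_comm (g _)]
  exact h

/-- `∫ ‖v‖² M_{1,0,1}(v) dv = 3`. [folklore] -/
theorem integral_normSq_mul_localMaxwellian : ∫ v : V3, ‖v‖ ^ 2 * localMaxwellian 1 1 (0 : V3) v = 3 := by
  rw [integral_mul_localMaxwellian_one_zero, integral_norm_sq_stdGaussian]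
  simp

/-- `∫ ‖v‖⁴ M_{1,0,1}(v) dv = 15` (Wick: `d(d+2)` at `d = 3`,
`Literature.Probability.Distributions.integral_norm_pow_four_stdGaussian`). [folklore] -/
theorem integral_normSq_sq_mul_localMaxwellian :
    ∫ v : V3, ‖v‖ ^ 4 * localMaxwellian 1 1 (0 : V3) v = 15 := by
  rw [integral_mul_localMaxwellian_one_zero,
    Literature.Probability.Distributions.integral_norm_pow_four_stdGaussian (EuclideanSpace.basisFun (Fin 3) ℝ)]
  norm_num

/-- `∫ M_{1,0,1}(v) dv = 1`. [folklore] -/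
theorem integral_one_mul_localMaxwellian : ∫ v : V3, (1 : ℝ) * localMaxwellian 1 1 (0 : V3) v = 1 := by
  rw [integral_mul_localMaxwellian_one_zero, integral_const, smul_eq_mul, mul_one, probReal_univ]

/-- **`F = a + b‖v‖²` against the Maxwellian**: `∫ (a + b‖v‖²) M = a + 3b`. [folklore] -/
theorem integral_affine_normSq_mul_localMaxwellian (a b : ℝ) :
    ∫ v : V3, (a + b * ‖v‖ ^ 2) * localMaxwellian 1 1 (0 : V3) v = a + 3 * b := by
  rw [integral_mul_localMaxwellian_one_zero, integral_add (integrable_const a)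
    (integrable_norm_sq_stdGaussian.const_mul b), integral_const, integral_const_mul,
    integral_norm_sq_stdGaussian, probReal_univ, one_smul]
  simp only [Fintype.card_fin, Nat.cast_ofNat]
  ring

/-- **`F = a + b‖v‖²` against `|v|² M`**: `∫ (a + b‖v‖²)‖v‖² M = 3a + 15b`. [folklore] -/
theorem integral_affine_normSq_mul_normSq_mul_localMaxwellian (a b : ℝ) :
    ∫ v : V3, (a + b * ‖v‖ ^ 2) * ‖v‖ ^ 2 * localMaxwellian 1 1 (0 : V3) v = 3 * a + 15 * b := by
  have h4 : ∀ v : V3, (a + b * ‖v‖ ^ 2) * ‖v‖ ^ 2 = a * ‖v‖ ^ 2 + b * ‖v‖ ^ 4 := fun v => by ring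
  simp_rw [h4]
  rw [integral_mul_localMaxwellian_one_zero, integral_add (integrable_norm_sq_stdGaussian.const_mul a)
    (integrable_norm_pow_four_stdGaussian.const_mul b), integral_const_mul, integral_const_mul,
    integral_norm_sq_stdGaussian,
    Literature.Probability.Distributions.integral_norm_pow_four_stdGaussian (EuclideanSpace.basisFun (Fin 3) ℝ)]
  simp only [Fintype.card_fin, Nat.cast_ofNat]
  ring

/-- **Functions of the speed are orthogonal to every velocity component** under `M_{1,0,θ}` (odd under
`v_j ↦ -v_j`; no integrability needed). [folklore] -/
theorem integral_radial_mul_coord_mul_localMaxwellian (g : ℝ → ℝ) (θ : ℝ) (j : Fin 3) :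
    ∫ v : V3, g (‖v‖ ^ 2) * v j * localMaxwellian 1 θ (0 : V3) v = 0 := by
  obtain ⟨R, hR⟩ := exists_velFlip j
  refine integral_eq_zero_of_odd_linearIsometryEquiv R fun v => ?_
  rw [localMaxwellian_linearIsometryEquiv, hR v j, if_pos rfl, LinearIsometryEquiv.norm_map]
  ring

/-- **A velocity component is orthogonal to the constants** under `M_{1,0,θ}`. [folklore] -/
theorem integral_coord_mul_localMaxwellian (θ : ℝ) (k : Fin 3) :
    ∫ v : V3, v k * localMaxwellian 1 θ (0 : V3) v = 0 := by
  have h := integral_radial_mul_coord_mul_localMaxwellian (fun _ => 1) θ k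
  simpa using h

/-- **A velocity component is orthogonal to the kinetic energy** under `M_{1,0,θ}`. [folklore] -/
theorem integral_coord_mul_normSq_mul_localMaxwellian (θ : ℝ) (k : Fin 3) :
    ∫ v : V3, v k * ‖v‖ ^ 2 * localMaxwellian 1 θ (0 : V3) v = 0 := by
  have h := integral_radial_mul_coord_mul_localMaxwellian (fun s => s) θ k
  simp only at h
  simpa [mul_comm (‖_‖ ^ 2)] using h

/-- **Products of two distinct velocity components are odd**: `∫ vₖ vⱼ M = 0` for `j ≠ k`, and
`∫ vₖ vₖ M`… is not claimed (it is `θ`). Stated for the witness `F = vₖ`: `∫ vₖ · vⱼ · M = 0` when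
`j ≠ k`. [folklore] -/
theorem integral_coord_mul_coord_mul_localMaxwellian_of_ne (θ : ℝ) {j k : Fin 3} (hjk : j ≠ k) :
    ∫ v : V3, v k * v j * localMaxwellian 1 θ (0 : V3) v = 0 := by
  obtain ⟨R, hR⟩ := exists_velFlip j
  refine integral_eq_zero_of_odd_linearIsometryEquiv R fun v => ?_
  rw [localMaxwellian_linearIsometryEquiv, hR v j, hR v k, if_pos rfl, if_neg (Ne.symm hjk)]
  ring


/-! ## (a.3) `F ⊥ |v|²` is load-bearing (to land as `Negative/WithoutOrthEnergy.lean`) -/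


/-- `TwoClocks.EquilibriumFastWindowLD` with the clause `F ⊥ |v|²` (`∀ x, ∫ F(x,v)‖v‖² M = 0`) DELETED;
all other tokens verbatim. A variant statement refuted below, not a fact. -/
def EquilibriumFastWindowLDWithoutOrthEnergy : Prop :=
  ∃ σ₀ : ℝ, 0 < σ₀ ∧ ∀ (a₀ θ₀ : ℝ) (u₀ : V3), 0 < a₀ → 0 < θ₀ → ∀ σ : ℝ, 0 < σ → σ < σ₀ →
    ∀ Φ : (N : ℕ) → HardSphereFlow (Torus.geometry (Fin 3)) (hsDiameter σ N) (N + 1),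
    ∀ F : T3 × V3 → ℝ, Continuous F → (∃ C : ℝ, ∀ y, |F y| ≤ C * (1 + ‖y.2‖ ^ 2)) →
    (∀ x, ∫ v, F (x, v) * localMaxwellian 1 θ₀ u₀ v = 0) →
    (∀ x (j : Fin 3), ∫ v, F (x, v) * v j * localMaxwellian 1 θ₀ u₀ v = 0) →
    ∃ β₀ : ℝ, 0 < β₀ ∧ ∀ β : ℝ, |β| ≤ β₀ → ∀ ε : ℝ, 0 < ε → ∃ τ : ℝ, 0 < τ ∧ ∃ N₀ : ℕ,
      ∀ N : ℕ, N₀ ≤ N →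
        ∫⁻ z, ENNReal.ofReal (Real.exp (β * ∑ i : Fin (N + 1),
            (τ * ((N : ℝ) + 1) ^ (-(1 / 3 : ℝ)))⁻¹ *
              ∫ r in (0 : ℝ)..(τ * ((N : ℝ) + 1) ^ (-(1 / 3 : ℝ))), F (((Φ N).flow r z) i)))
          ∂(localGibbsLaw σ (fun _ => a₀) (fun _ => u₀) (fun _ => θ₀) N (Φ N)) ≤
        ENNReal.ofReal (Real.exp (ε * ((N : ℝ) + 1)))

/-- **The per-particle factor of an affine energy observable is an exact exponential**: for `0 < 1 - 2c`,
`e^{x} ((1-2c)^{-1/2})³ = exp(x − (3/2) log(1−2c))`. [folklore] -/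
theorem exp_mul_rpow_cube_eq_exp (x : ℝ) {c : ℝ} (hc : 0 < 1 - 2 * c) :
    Real.exp x * ((1 - 2 * c) ^ (-(1 / 2 : ℝ))) ^ 3 = Real.exp (x - 3 / 2 * Real.log (1 - 2 * c)) := by
  rw [Real.rpow_def_of_pos hc, ← Real.exp_nat_mul, ← Real.exp_add]
  congr 1
  push_cast
  ring

/-- **An exact exponential moment twice too large contradicts the conclusion**: if `ε > 0` and the
window moment equals `(e^{2ε})^{N+1}` in the form produced by `windowMoment_affine_normSq_eq`, it is not
`≤ exp(ε(N+1))`. [folklore] -/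
theorem not_le_of_moment_eq {M : ℝ≥0∞} {x c ε : ℝ} (hc : 0 < 1 - 2 * c) (hε : 0 < ε)
    (h2ε : x - 3 / 2 * Real.log (1 - 2 * c) = 2 * ε) (N : ℕ)
    (hM : M = (ENNReal.ofReal (Real.exp x) * ENNReal.ofReal ((1 - 2 * c) ^ (-(1 / 2 : ℝ))) ^ 3) ^ (N + 1)) :
    ¬ M ≤ ENNReal.ofReal (Real.exp (ε * ((N : ℝ) + 1))) := by
  have hr : 0 ≤ (1 - 2 * c) ^ (-(1 / 2 : ℝ)) := Real.rpow_nonneg hc.le _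
  rw [hM, ← ENNReal.ofReal_pow hr, ← ENNReal.ofReal_mul (Real.exp_pos _).le,
    exp_mul_rpow_cube_eq_exp x hc, h2ε, ← ENNReal.ofReal_pow (Real.exp_pos _).le, ← Real.exp_nat_mul,
    ENNReal.ofReal_le_ofReal_iff (Real.exp_pos _).le, Real.exp_le_exp, not_le]
  push_cast
  nlinarith

/-- **(a.3) Orthogonality to `|v|²` is load-bearing.** [folklore] -/
theorem equilibriumFastWindowLD_false_without_orthEnergy : ¬ EquilibriumFastWindowLDWithoutOrthEnergy := by
  rintro ⟨σ₀, hσ₀, h⟩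
  -- a reduced density in range and the Alexander flows
  set σ : ℝ := min (σ₀ / 2) (1 / 4) with hσdef
  have hσpos : 0 < σ := lt_min (by linarith) (by norm_num)
  have hσlt : σ < σ₀ := (min_le_left _ _).trans_lt (by linarith)
  have hσ2 : σ ≤ 1 / 2 := (min_le_right _ _).trans (by norm_num)
  have hσhalf : σ < 2⁻¹ := (min_le_right _ _).trans_lt (by norm_num)
  set Φ : (N : ℕ) → HardSphereFlow (Torus.geometry (Fin 3)) (hsDiameter σ N) (N + 1) :=
    fun N => Classical.choice (nonempty_flow hσpos hσhalf N) with hΦdef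
  -- the witness `F(x,v) = -3 + 1·‖v‖²`
  set F : T3 × V3 → ℝ := fun y => -3 + 1 * ‖y.2‖ ^ 2 with hFdef
  have hFc : Continuous F := by rw [hFdef]; fun_prop
  have hFg : ∃ C : ℝ, ∀ y, |F y| ≤ C * (1 + ‖y.2‖ ^ 2) := by
    refine ⟨3, fun y => ?_⟩
    rw [hFdef]
    have h0 : 0 ≤ ‖y.2‖ ^ 2 := sq_nonneg _
    rw [abs_le]
    constructor <;> nlinarith
  have hF1 : ∀ x : T3, ∫ v, F (x, v) * localMaxwellian 1 1 (0 : V3) v = 0 := by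
    intro x
    simp only [hFdef]
    rw [integral_affine_normSq_mul_localMaxwellian (-3) 1]
    norm_num
  have hFv : ∀ (x : T3) (j : Fin 3), ∫ v, F (x, v) * v j * localMaxwellian 1 1 (0 : V3) v = 0 := by
    intro x j
    simp only [hFdef]
    exact integral_radial_mul_coord_mul_localMaxwellian (fun s => -3 + 1 * s) 1 j
  obtain ⟨β₀, hβ₀, hβ⟩ := h 1 1 0 one_pos one_pos σ hσpos hσlt Φ F hFc hFg hF1 hFv
  -- a tilt in range and the doubled exponent
  set β : ℝ := min β₀ (1 / 4) with hβdef
  have hβpos : 0 < β := lt_min hβ₀ (by norm_num)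
  have hβle : |β| ≤ β₀ := by rw [abs_of_pos hβpos]; exact min_le_left _ _
  have hβ4 : β ≤ 1 / 4 := min_le_right _ _
  have hc : 0 < 1 - 2 * (β * 1) := by linarith
  set ε : ℝ := (β * (-3) - 3 / 2 * Real.log (1 - 2 * (β * 1))) / 2 with hεdef
  have hlog : Real.log (1 - 2 * (β * 1)) < -2 * β := by
    have h := Real.log_lt_sub_one_of_pos hc (by linarith)
    linarith
  have hε : 0 < ε := by rw [hεdef]; linarith
  obtain ⟨τ, hτ, N₀, hN⟩ := hβ β hβle ε hε
  have hw : 0 < τ * ((N₀ : ℝ) + 1) ^ (-(1 / 3 : ℝ)) := mul_pos hτ (Real.rpow_pos_of_pos (by positivity) _)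
  have hval := windowMoment_affine_normSq_eq one_pos hσ2 N₀ (Φ N₀) (-3) 1 (β := β) (by linarith) hw
  exact not_le_of_moment_eq hc hε (by rw [hεdef]; ring) N₀ hval (hN N₀ le_rfl)


/-! ## (a.1) `F ⊥ 1` is load-bearing (to land as `Negative/WithoutOrthOne.lean`) -/


/-- `TwoClocks.EquilibriumFastWindowLD` with the clause `F ⊥ 1` (`∀ x, ∫ F(x,v) M = 0`) DELETED; all
other tokens verbatim. A variant statement refuted below, not a fact. -/
def EquilibriumFastWindowLDWithoutOrthOne : Prop :=
  ∃ σ₀ : ℝ, 0 < σ₀ ∧ ∀ (a₀ θ₀ : ℝ) (u₀ : V3), 0 < a₀ → 0 < θ₀ → ∀ σ : ℝ, 0 < σ → σ < σ₀ →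
    ∀ Φ : (N : ℕ) → HardSphereFlow (Torus.geometry (Fin 3)) (hsDiameter σ N) (N + 1),
    ∀ F : T3 × V3 → ℝ, Continuous F → (∃ C : ℝ, ∀ y, |F y| ≤ C * (1 + ‖y.2‖ ^ 2)) →
    (∀ x (j : Fin 3), ∫ v, F (x, v) * v j * localMaxwellian 1 θ₀ u₀ v = 0) →
    (∀ x, ∫ v, F (x, v) * ‖v‖ ^ 2 * localMaxwellian 1 θ₀ u₀ v = 0) →
    ∃ β₀ : ℝ, 0 < β₀ ∧ ∀ β : ℝ, |β| ≤ β₀ → ∀ ε : ℝ, 0 < ε → ∃ τ : ℝ, 0 < τ ∧ ∃ N₀ : ℕ,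
      ∀ N : ℕ, N₀ ≤ N →
        ∫⁻ z, ENNReal.ofReal (Real.exp (β * ∑ i : Fin (N + 1),
            (τ * ((N : ℝ) + 1) ^ (-(1 / 3 : ℝ)))⁻¹ *
              ∫ r in (0 : ℝ)..(τ * ((N : ℝ) + 1) ^ (-(1 / 3 : ℝ))), F (((Φ N).flow r z) i)))
          ∂(localGibbsLaw σ (fun _ => a₀) (fun _ => u₀) (fun _ => θ₀) N (Φ N)) ≤
        ENNReal.ofReal (Real.exp (ε * ((N : ℝ) + 1)))

/-- **(a.1) Orthogonality to the constants is load-bearing.** [folklore] -/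
theorem equilibriumFastWindowLD_false_without_orthOne : ¬ EquilibriumFastWindowLDWithoutOrthOne := by
  rintro ⟨σ₀, hσ₀, h⟩
  set σ : ℝ := min (σ₀ / 2) (1 / 4) with hσdef
  have hσpos : 0 < σ := lt_min (by linarith) (by norm_num)
  have hσlt : σ < σ₀ := (min_le_left _ _).trans_lt (by linarith)
  have hσ2 : σ ≤ 1 / 2 := (min_le_right _ _).trans (by norm_num)
  have hσhalf : σ < 2⁻¹ := (min_le_right _ _).trans_lt (by norm_num)
  set Φ : (N : ℕ) → HardSphereFlow (Torus.geometry (Fin 3)) (hsDiameter σ N) (N + 1) :=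
    fun N => Classical.choice (nonempty_flow hσpos hσhalf N) with hΦdef
  -- the witness `F(x,v) = 5 + (-1)·‖v‖²`
  set F : T3 × V3 → ℝ := fun y => 5 + (-1) * ‖y.2‖ ^ 2 with hFdef
  have hFc : Continuous F := by rw [hFdef]; fun_prop
  have hFg : ∃ C : ℝ, ∀ y, |F y| ≤ C * (1 + ‖y.2‖ ^ 2) := by
    refine ⟨5, fun y => ?_⟩
    rw [hFdef]
    have h0 : 0 ≤ ‖y.2‖ ^ 2 := sq_nonneg _
    rw [abs_le]
    constructor <;> nlinarith
  have hFv : ∀ (x : T3) (j : Fin 3), ∫ v, F (x, v) * v j * localMaxwellian 1 1 (0 : V3) v = 0 := by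
    intro x j
    simp only [hFdef]
    exact integral_radial_mul_coord_mul_localMaxwellian (fun s => 5 + (-1) * s) 1 j
  have hFE : ∀ x : T3, ∫ v, F (x, v) * ‖v‖ ^ 2 * localMaxwellian 1 1 (0 : V3) v = 0 := by
    intro x
    simp only [hFdef]
    rw [integral_affine_normSq_mul_normSq_mul_localMaxwellian 5 (-1)]
    norm_num
  obtain ⟨β₀, hβ₀, hβ⟩ := h 1 1 0 one_pos one_pos σ hσpos hσlt Φ F hFc hFg hFv hFE
  set β : ℝ := min β₀ (1 / 4) with hβdef
  have hβpos : 0 < β := lt_min hβ₀ (by norm_num)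
  have hβle : |β| ≤ β₀ := by rw [abs_of_pos hβpos]; exact min_le_left _ _
  have hc : 0 < 1 - 2 * (β * (-1)) := by linarith
  set ε : ℝ := (β * 5 - 3 / 2 * Real.log (1 - 2 * (β * (-1)))) / 2 with hεdef
  have hlog : Real.log (1 - 2 * (β * (-1))) < 2 * β := by
    have h := Real.log_lt_sub_one_of_pos hc (by linarith)
    linarith
  have hε : 0 < ε := by rw [hεdef]; linarith
  obtain ⟨τ, hτ, N₀, hN⟩ := hβ β hβle ε hε
  have hw : 0 < τ * ((N₀ : ℝ) + 1) ^ (-(1 / 3 : ℝ)) := mul_pos hτ (Real.rpow_pos_of_pos (by positivity) _)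
  have hval := windowMoment_affine_normSq_eq one_pos hσ2 N₀ (Φ N₀) 5 (-1) (β := β) (by linarith) hw
  exact not_le_of_moment_eq hc hε (by rw [hεdef]; ring) N₀ hval (hN N₀ le_rfl)


/-! ## (a.2) `F ⊥ v_j` is load-bearing (to land as `Negative/WithoutOrthMomentum.lean`) -/


/-- `TwoClocks.EquilibriumFastWindowLD` with the clause `F ⊥ v_j` (`∀ x j, ∫ F(x,v) v_j M = 0`) DELETED;
all other tokens verbatim. A variant statement refuted below, not a fact. -/
def EquilibriumFastWindowLDWithoutOrthMomentum : Prop :=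
  ∃ σ₀ : ℝ, 0 < σ₀ ∧ ∀ (a₀ θ₀ : ℝ) (u₀ : V3), 0 < a₀ → 0 < θ₀ → ∀ σ : ℝ, 0 < σ → σ < σ₀ →
    ∀ Φ : (N : ℕ) → HardSphereFlow (Torus.geometry (Fin 3)) (hsDiameter σ N) (N + 1),
    ∀ F : T3 × V3 → ℝ, Continuous F → (∃ C : ℝ, ∀ y, |F y| ≤ C * (1 + ‖y.2‖ ^ 2)) →
    (∀ x, ∫ v, F (x, v) * localMaxwellian 1 θ₀ u₀ v = 0) →
    (∀ x, ∫ v, F (x, v) * ‖v‖ ^ 2 * localMaxwellian 1 θ₀ u₀ v = 0) →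
    ∃ β₀ : ℝ, 0 < β₀ ∧ ∀ β : ℝ, |β| ≤ β₀ → ∀ ε : ℝ, 0 < ε → ∃ τ : ℝ, 0 < τ ∧ ∃ N₀ : ℕ,
      ∀ N : ℕ, N₀ ≤ N →
        ∫⁻ z, ENNReal.ofReal (Real.exp (β * ∑ i : Fin (N + 1),
            (τ * ((N : ℝ) + 1) ^ (-(1 / 3 : ℝ)))⁻¹ *
              ∫ r in (0 : ℝ)..(τ * ((N : ℝ) + 1) ^ (-(1 / 3 : ℝ))), F (((Φ N).flow r z) i)))
          ∂(localGibbsLaw σ (fun _ => a₀) (fun _ => u₀) (fun _ => θ₀) N (Φ N)) ≤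
        ENNReal.ofReal (Real.exp (ε * ((N : ℝ) + 1)))

/-- `|v⁰| ≤ 1 + ‖v‖²` on `ℝ³`. [folklore] -/
theorem abs_coord_le_one_add_norm_sq (v : V3) (k : Fin 3) : |v k| ≤ 1 + ‖v‖ ^ 2 := by
  have h1 : |v k| ≤ ‖v‖ := by simpa [Real.norm_eq_abs] using PiLp.norm_apply_le v k
  nlinarith [norm_nonneg v, sq_nonneg (‖v‖ - 1)]

/-- **(a.2) Orthogonality to the momentum is load-bearing.** [folklore] -/
theorem equilibriumFastWindowLD_false_without_orthMomentum : ¬ EquilibriumFastWindowLDWithoutOrthMomentum := by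
  rintro ⟨σ₀, hσ₀, h⟩
  set σ : ℝ := min (σ₀ / 2) (1 / 4) with hσdef
  have hσpos : 0 < σ := lt_min (by linarith) (by norm_num)
  have hσlt : σ < σ₀ := (min_le_left _ _).trans_lt (by linarith)
  have hσ2 : σ ≤ 1 / 2 := (min_le_right _ _).trans (by norm_num)
  have hσhalf : σ < 2⁻¹ := (min_le_right _ _).trans_lt (by norm_num)
  set Φ : (N : ℕ) → HardSphereFlow (Torus.geometry (Fin 3)) (hsDiameter σ N) (N + 1) :=
    fun N => Classical.choice (nonempty_flow hσpos hσhalf N) with hΦdef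
  -- the witness `F(x,v) = v⁰`
  set F : T3 × V3 → ℝ := fun y => y.2 0 with hFdef
  have hFc : Continuous F := by rw [hFdef]; fun_prop
  have hFg : ∃ C : ℝ, ∀ y, |F y| ≤ C * (1 + ‖y.2‖ ^ 2) :=
    ⟨1, fun y => by rw [hFdef, one_mul]; exact abs_coord_le_one_add_norm_sq y.2 0⟩
  have hF1 : ∀ x : T3, ∫ v, F (x, v) * localMaxwellian 1 1 (0 : V3) v = 0 := fun x => by
    simp only [hFdef]; exact integral_coord_mul_localMaxwellian 1 0
  have hFE : ∀ x : T3, ∫ v, F (x, v) * ‖v‖ ^ 2 * localMaxwellian 1 1 (0 : V3) v = 0 := fun x => by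
    simp only [hFdef]; exact integral_coord_mul_normSq_mul_localMaxwellian 1 0
  obtain ⟨β₀, hβ₀, hβ⟩ := h 1 1 0 one_pos one_pos σ hσpos hσlt Φ F hFc hFg hF1 hFE
  have hβle : |β₀| ≤ β₀ := (abs_of_pos hβ₀).le
  obtain ⟨τ, hτ, N₀, hN⟩ := hβ β₀ hβle (β₀ ^ 2 / 4) (by positivity)
  have hw : 0 < τ * ((N₀ : ℝ) + 1) ^ (-(1 / 3 : ℝ)) := mul_pos hτ (Real.rpow_pos_of_pos (by positivity) _)
  have h0 := hN N₀ le_rfl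
  have hval := windowMoment_coord_eq one_pos hσ2 N₀ (Φ N₀) 0 β₀ hw
  simp only [hFdef] at h0
  rw [hval, ← ENNReal.ofReal_pow (Real.exp_pos _).le, ← Real.exp_nat_mul,
    ENNReal.ofReal_le_ofReal_iff (Real.exp_pos _).le, Real.exp_le_exp] at h0
  push_cast at h0
  nlinarith [sq_nonneg β₀, mul_pos (pow_pos hβ₀ 2) (show (0 : ℝ) < (N₀ : ℝ) + 1 by positivity)]



/-! ## (b.2) β-ceiling: the admissible `F_A` has infinite window moment for `βA ≥ ½` (to land as `Negative/BetaCeiling.lean`) -/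
section BetaCeiling
open Summit.AtomisticToContinuum.HydrodynamicLimit.Theorems.CorrectorPressureDecayNegative.OrthEnergy
  (integral_prod_coord_stdGaussian integral_exp_neg_mul_sq_gaussianReal integral_mul_exp_neg_mul_sq_gaussianReal
    integral_sq_gaussianReal)
open Summit.AtomisticToContinuum.HydrodynamicLimit.Theorems.CorrectorPressureDecayNegative.OrthMomentum
  (integral_coord_stdGaussian)


/-! ## Divergent quadratic exponential moments -/

/-- **`∫ e^{a x²} dN(0,1) = ∞` for `2a ≥ 1`** (the density `(2π)^{-1/2} e^{(a − ½)x²}` is bounded below by a positive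
constant on `ℝ`). [folklore] -/
theorem lintegral_exp_mul_sq_gaussianReal_eq_top {a : ℝ} (ha : 1 ≤ 2 * a) :
    ∫⁻ x, ENNReal.ofReal (Real.exp (a * x ^ 2)) ∂(gaussianReal 0 1) = ∞ := by
  rw [gaussianReal_of_var_ne_zero 0 one_ne_zero,
    lintegral_withDensity_eq_lintegral_mul₀ (measurable_gaussianPDF 0 1).aemeasurable
      (by fun_prop : Measurable fun x : ℝ => ENNReal.ofReal (Real.exp (a * x ^ 2))).aemeasurable]
  set c : ℝ≥0∞ := ENNReal.ofReal ((Real.sqrt (2 * π))⁻¹) with hc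
  have hc0 : c ≠ 0 := by
    rw [hc]
    exact (ENNReal.ofReal_pos.2 (by positivity)).ne'
  have hle : ∀ x : ℝ, c ≤ (gaussianPDF 0 1 * fun x => ENNReal.ofReal (Real.exp (a * x ^ 2))) x := by
    intro x
    simp only [Pi.mul_apply, gaussianPDF, gaussianPDFReal_def, NNReal.coe_one, mul_one, sub_zero]
    rw [← ENNReal.ofReal_mul (by positivity), hc, mul_assoc, ← Real.exp_add]
    refine ENNReal.ofReal_le_ofReal ?_
    have hexp : 1 ≤ Real.exp (-x ^ 2 / 2 + a * x ^ 2) := Real.one_le_exp (by nlinarith [sq_nonneg x])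
    have hs : 0 ≤ (Real.sqrt (2 * π))⁻¹ := by positivity
    nlinarith
  refine eq_top_iff.2 ?_
  calc (⊤ : ℝ≥0∞) = c * volume (Set.univ : Set ℝ) := by rw [Real.volume_univ, ENNReal.mul_top hc0]
    _ = ∫⁻ _ : ℝ, c := by rw [lintegral_const]
    _ ≤ _ := lintegral_mono hle

/-- **`∫ e^{s‖w‖²} dγ₃(w) = ∞` for `2s ≥ 1`** (bound below by the first coordinate). [folklore] -/
theorem lintegral_exp_mul_normSq_stdGaussian_eq_top {s : ℝ} (hs : 1 ≤ 2 * s) :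
    ∫⁻ w, ENNReal.ofReal (Real.exp (s * ‖w‖ ^ 2)) ∂(stdGaussian V3) = ∞ := by
  have hs0 : 0 ≤ s := by linarith
  have hle : ∀ w : V3, ENNReal.ofReal (Real.exp (s * (w 0) ^ 2)) ≤ ENNReal.ofReal (Real.exp (s * ‖w‖ ^ 2)) := by
    intro w
    refine ENNReal.ofReal_le_ofReal (Real.exp_le_exp.2 (mul_le_mul_of_nonneg_left ?_ hs0))
    have h1 : |w 0| ≤ ‖w‖ := by simpa [Real.norm_eq_abs] using PiLp.norm_apply_le w 0
    calc (w 0) ^ 2 = |w 0| ^ 2 := (sq_abs _).symm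
      _ ≤ ‖w‖ ^ 2 := pow_le_pow_left₀ (abs_nonneg _) h1 2
  refine eq_top_iff.2 ?_
  have hf : Measurable fun x : ℝ => ENNReal.ofReal (Real.exp (s * x ^ 2)) := by fun_prop
  calc (⊤ : ℝ≥0∞) = ∫⁻ x, ENNReal.ofReal (Real.exp (s * x ^ 2)) ∂(gaussianReal 0 1) :=
        (lintegral_exp_mul_sq_gaussianReal_eq_top hs).symm
    _ = ∫⁻ w, ENNReal.ofReal (Real.exp (s * (w 0) ^ 2)) ∂(stdGaussian V3) :=
        ((BoltzmannGreenKuboOrthMomentum.measurePreserving_coord 0).lintegral_comp hf).symm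
    _ ≤ _ := lintegral_mono hle

/-! ## The admissible witness `F_A = A(‖v‖² − 15 + 12√2 e^{−v₀²/2})`: Gaussian bookkeeping -/

/-- `∫ e^{−x²/2} dN(0,1) = (√2)⁻¹`. [folklore] -/
theorem integral_exp_neg_half_sq_gaussianReal :
    ∫ x, Real.exp (-(1 / 2) * x ^ 2) ∂(gaussianReal 0 1) = (Real.sqrt 2)⁻¹ := by
  have h := integral_exp_neg_mul_sq_gaussianReal (c := 1) (by norm_num)
  norm_num at h
  simpa using h

/-- `∫ x² e^{−x²/2} dN(0,1) = (√2)⁻¹³` (scaling identity of the cooled Gaussian). [folklore] -/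
theorem integral_sq_mul_exp_neg_half_sq_gaussianReal :
    ∫ x, x ^ 2 * Real.exp (-(1 / 2) * x ^ 2) ∂(gaussianReal 0 1) = (Real.sqrt 2)⁻¹ ^ 3 := by
  have h := integral_mul_exp_neg_mul_sq_gaussianReal (fun x => x ^ 2) (c := 1) (by norm_num)
  rw [show (1 : ℝ) + 1 = 2 by norm_num] at h
  rw [h]
  have h2 : ∫ y, ((Real.sqrt 2)⁻¹ * y) ^ 2 ∂(gaussianReal 0 1) = (Real.sqrt 2)⁻¹ ^ 2 := by
    simp_rw [mul_pow]
    rw [integral_const_mul, integral_sq_gaussianReal, mul_one]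
  rw [h2]
  ring

/-- Independence of the coordinates `0` and `k ≠ 0` under `γ₃`, for the two factors used below:
`∫ g(w₀) h(wₖ) dγ₃ = (∫ g dγ₁)(∫ h dγ₁)`. [folklore] -/
theorem integral_coord_zero_mul_coord_stdGaussian {g h : ℝ → ℝ} (hg : Measurable g) (hh : Measurable h)
    {k : Fin 3} (hk : k ≠ 0) :
    ∫ w, g (w 0) * h (w k) ∂(stdGaussian V3) = (∫ x, g x ∂(gaussianReal 0 1)) * ∫ x, h x ∂(gaussianReal 0 1) := by
  classical
  set f : Fin 3 → ℝ → ℝ := fun l => if l = 0 then g else if l = k then h else fun _ => 1 with hf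
  have hfm : ∀ l, Measurable (f l) := by
    intro l
    by_cases hl0 : l = 0
    · simp only [hf, if_pos hl0]; exact hg
    · by_cases hlk : l = k
      · simp only [hf, if_neg hl0, if_pos hlk]; exact hh
      · simp only [hf, if_neg hl0, if_neg hlk]; exact measurable_const
  have hf0 : f 0 = g := by simp only [hf, if_pos rfl]
  have hfk : f k = h := by simp [hf, hk]
  have hfo : ∀ l, l ≠ 0 → l ≠ k → f l = fun _ => 1 := fun l hl0 hlk => by simp only [hf, if_neg hl0, if_neg hlk]
  -- the third index
  obtain ⟨m, hm0, hmk, huniv⟩ : ∃ m : Fin 3, m ≠ 0 ∧ m ≠ k ∧ ∀ l : Fin 3, l = 0 ∨ l = k ∨ l = m := by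
    fin_cases k
    · exact absurd rfl hk
    · exact ⟨2, by decide, by decide, fun l => by fin_cases l <;> decide⟩
    · exact ⟨1, by decide, by decide, fun l => by fin_cases l <;> decide⟩
  have hprod : ∀ (φ : Fin 3 → ℝ), ∏ l, φ l = φ 0 * φ k * φ m := by
    intro φ
    have huniv' : (Finset.univ : Finset (Fin 3)) = {0, k, m} := by
      ext l; simp only [Finset.mem_univ, Finset.mem_insert, Finset.mem_singleton, true_iff]; exact huniv l
    rw [huniv', Finset.prod_insert (by simp [hk.symm, hm0.symm]), Finset.prod_insert (by simp [hmk.symm]),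
      Finset.prod_singleton, mul_assoc]
  have hpt : ∀ w : V3, g (w 0) * h (w k) = ∏ l, f l (w l) := by
    intro w
    rw [hprod, hf0, hfk, hfo m hm0 hmk, mul_one]
  simp_rw [hpt]
  rw [integral_prod_coord_stdGaussian f hfm, hprod, hf0, hfk, hfo m hm0 hmk, integral_const, smul_eq_mul,
    mul_one, probReal_univ, mul_one]

/-- `∫ e^{−v₀²/2} dγ₃ = (√2)⁻¹`. [folklore] -/
theorem integral_expWeight_stdGaussian :
    ∫ w, Real.exp (-(1 / 2) * (w 0) ^ 2) ∂(stdGaussian V3) = (Real.sqrt 2)⁻¹ := by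
  rw [integral_coord_stdGaussian 0 (by fun_prop : Measurable fun x : ℝ => Real.exp (-(1 / 2) * x ^ 2)),
    integral_exp_neg_half_sq_gaussianReal]

/-- `∫ ‖w‖² e^{−v₀²/2} dγ₃ = (√2)⁻¹³ + 2(√2)⁻¹` (split `‖w‖² = w₀² + w₁² + w₂²`; independent coordinates). [folklore] -/
theorem integral_normSq_mul_expWeight_stdGaussian :
    ∫ w, ‖w‖ ^ 2 * Real.exp (-(1 / 2) * (w 0) ^ 2) ∂(stdGaussian V3) =
      (Real.sqrt 2)⁻¹ ^ 3 + 2 * (Real.sqrt 2)⁻¹ := by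
  -- the three coordinate products
  have h0 : ∫ w, (w 0) ^ 2 * Real.exp (-(1 / 2) * (w 0) ^ 2) ∂(stdGaussian V3) = (Real.sqrt 2)⁻¹ ^ 3 := by
    rw [integral_coord_stdGaussian 0
      (by fun_prop : Measurable fun x : ℝ => x ^ 2 * Real.exp (-(1 / 2) * x ^ 2)),
      integral_sq_mul_exp_neg_half_sq_gaussianReal]
  have hprod : ∀ k : Fin 3, k ≠ 0 →
      ∫ w, (w k) ^ 2 * Real.exp (-(1 / 2) * (w 0) ^ 2) ∂(stdGaussian V3) = (Real.sqrt 2)⁻¹ := by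
    intro k hk
    have h := integral_coord_zero_mul_coord_stdGaussian
      (by fun_prop : Measurable fun x : ℝ => Real.exp (-(1 / 2) * x ^ 2))
      (by fun_prop : Measurable fun x : ℝ => x ^ 2) hk
    simp_rw [mul_comm (Real.exp _)] at h
    rw [h, integral_exp_neg_half_sq_gaussianReal, integral_sq_gaussianReal, mul_one]
  have hsplit : ∀ w : V3, ‖w‖ ^ 2 * Real.exp (-(1 / 2) * (w 0) ^ 2) =
      (w 0) ^ 2 * Real.exp (-(1 / 2) * (w 0) ^ 2) + (w 1) ^ 2 * Real.exp (-(1 / 2) * (w 0) ^ 2) +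
        (w 2) ^ 2 * Real.exp (-(1 / 2) * (w 0) ^ 2) := by
    intro w
    rw [BoltzmannGreenKuboForallN.norm_sq_eq_three]
    ring
  simp_rw [hsplit]
  -- integrability of each term: bounded by `(w k)²`
  have hint : ∀ k : Fin 3, Integrable (fun w : V3 => (w k) ^ 2 * Real.exp (-(1 / 2) * (w 0) ^ 2))
      (stdGaussian V3) := by
    intro k
    refine ((memLp_coord_stdGaussian k 2 (by simp)).integrable_sq).mono' (by fun_prop) (ae_of_all _ fun w => ?_)
    rw [Real.norm_eq_abs, abs_mul, abs_of_nonneg (sq_nonneg _), abs_of_pos (Real.exp_pos _)]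
    refine mul_le_of_le_one_right (sq_nonneg _) ?_
    rw [Real.exp_le_one_iff]
    nlinarith [sq_nonneg (w 0)]
  have h01 : Integrable (fun w : V3 => (w 0) ^ 2 * Real.exp (-(1 / 2) * (w 0) ^ 2) +
      (w 1) ^ 2 * Real.exp (-(1 / 2) * (w 0) ^ 2)) (stdGaussian V3) := (hint 0).add (hint 1)
  rw [integral_add h01 (hint 2), integral_add (hint 0) (hint 1), h0,
    hprod 1 (by decide), hprod 2 (by decide)]
  ring

/-- **`F_A ⊥ 1`**: `∫ A(‖v‖² − 15 + 12√2 e^{−v₀²/2}) M_{1,0,1} dv = 0`. [folklore] -/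
theorem integral_FA_mul_localMaxwellian (A : ℝ) :
    ∫ v : V3, A * (‖v‖ ^ 2 - 15 + 12 * Real.sqrt 2 * Real.exp (-(1 / 2) * (v 0) ^ 2)) *
      localMaxwellian 1 1 (0 : V3) v = 0 := by
  rw [integral_mul_localMaxwellian_one_zero]
  have hint1 : Integrable (fun w : V3 => ‖w‖ ^ 2 - 15) (stdGaussian V3) :=
    integrable_norm_sq_stdGaussian.sub (integrable_const _)
  have hint2 : Integrable (fun w : V3 => 12 * Real.sqrt 2 * Real.exp (-(1 / 2) * (w 0) ^ 2)) (stdGaussian V3) := by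
    refine (integrable_const (12 * Real.sqrt 2)).mono' (by fun_prop) (ae_of_all _ fun w => ?_)
    rw [Real.norm_eq_abs, abs_mul, abs_of_nonneg (by positivity : (0 : ℝ) ≤ 12 * Real.sqrt 2),
      abs_of_pos (Real.exp_pos _)]
    refine mul_le_of_le_one_right (by positivity) ?_
    rw [Real.exp_le_one_iff]
    nlinarith [sq_nonneg (w 0)]
  simp_rw [mul_comm A, integral_mul_const]
  rw [integral_add hint1 hint2, integral_sub integrable_norm_sq_stdGaussian (integrable_const _),
    integral_norm_sq_stdGaussian, integral_const, integral_const_mul, integral_expWeight_stdGaussian]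
  simp only [Fintype.card_fin, Nat.cast_ofNat, smul_eq_mul, probReal_univ, one_mul]
  have hs : Real.sqrt 2 * (Real.sqrt 2)⁻¹ = 1 := mul_inv_cancel₀ (by positivity)
  have hE : (3 : ℝ) - 15 + 12 * Real.sqrt 2 * (Real.sqrt 2)⁻¹ = 0 := by linear_combination 12 * hs
  rw [hE, zero_mul]

/-- **`F_A ⊥ |v|²`**: `∫ A(‖v‖² − 15 + 12√2 e^{−v₀²/2}) ‖v‖² M_{1,0,1} dv = 0` (`15 − 45 + 30`). [folklore] -/
theorem integral_FA_mul_normSq_mul_localMaxwellian (A : ℝ) :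
    ∫ v : V3, A * (‖v‖ ^ 2 - 15 + 12 * Real.sqrt 2 * Real.exp (-(1 / 2) * (v 0) ^ 2)) * ‖v‖ ^ 2 *
      localMaxwellian 1 1 (0 : V3) v = 0 := by
  rw [integral_mul_localMaxwellian_one_zero]
  have hpt : ∀ w : V3, A * (‖w‖ ^ 2 - 15 + 12 * Real.sqrt 2 * Real.exp (-(1 / 2) * (w 0) ^ 2)) * ‖w‖ ^ 2 =
      ((‖w‖ ^ 4 - 15 * ‖w‖ ^ 2) + 12 * Real.sqrt 2 * (‖w‖ ^ 2 * Real.exp (-(1 / 2) * (w 0) ^ 2))) * A := by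
    intro w; ring
  simp_rw [hpt]
  have hint1 : Integrable (fun w : V3 => ‖w‖ ^ 4 - 15 * ‖w‖ ^ 2) (stdGaussian V3) :=
    integrable_norm_pow_four_stdGaussian.sub (integrable_norm_sq_stdGaussian.const_mul _)
  have hint2' : Integrable (fun w : V3 => ‖w‖ ^ 2 * Real.exp (-(1 / 2) * (w 0) ^ 2)) (stdGaussian V3) := by
    refine integrable_norm_sq_stdGaussian.mono' (by fun_prop) (ae_of_all _ fun w => ?_)
    rw [Real.norm_eq_abs, abs_mul, abs_of_nonneg (sq_nonneg _), abs_of_pos (Real.exp_pos _)]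
    refine mul_le_of_le_one_right (sq_nonneg _) ?_
    rw [Real.exp_le_one_iff]
    nlinarith [sq_nonneg (w 0)]
  rw [integral_mul_const, integral_add hint1 (hint2'.const_mul _),
    integral_sub integrable_norm_pow_four_stdGaussian (integrable_norm_sq_stdGaussian.const_mul _),
    integral_const_mul, integral_const_mul, integral_norm_sq_stdGaussian,
    Literature.Probability.Distributions.integral_norm_pow_four_stdGaussian (EuclideanSpace.basisFun (Fin 3) ℝ),
    integral_normSq_mul_expWeight_stdGaussian]
  simp only [Fintype.card_fin, Nat.cast_ofNat]
  have hs : Real.sqrt 2 * (Real.sqrt 2)⁻¹ = 1 := mul_inv_cancel₀ (by positivity)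
  have hs2 : (Real.sqrt 2)⁻¹ ^ 2 = 1 / 2 := by
    rw [inv_pow, Real.sq_sqrt (by norm_num : (0 : ℝ) ≤ 2)]
    norm_num
  have hE : (3 : ℝ) * (3 + 2) - 15 * 3 + 12 * Real.sqrt 2 * ((Real.sqrt 2)⁻¹ ^ 3 + 2 * (Real.sqrt 2)⁻¹) = 0 := by
    linear_combination (12 * (Real.sqrt 2)⁻¹ ^ 2 + 24) * hs + 12 * hs2
  rw [hE, zero_mul]

/-- **`F_A ⊥ v_j`** (even in every coordinate). [folklore] -/
theorem integral_FA_mul_coord_mul_localMaxwellian (A : ℝ) (j : Fin 3) :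
    ∫ v : V3, A * (‖v‖ ^ 2 - 15 + 12 * Real.sqrt 2 * Real.exp (-(1 / 2) * (v 0) ^ 2)) * v j *
      localMaxwellian 1 1 (0 : V3) v = 0 := by
  obtain ⟨R, hR⟩ := exists_velFlip j
  refine integral_eq_zero_of_odd_linearIsometryEquiv R fun v => ?_
  have h0 : (R v 0) ^ 2 = (v 0) ^ 2 := by
    rw [hR v 0]
    split_ifs <;> ring
  rw [localMaxwellian_linearIsometryEquiv, hR v j, if_pos rfl, LinearIsometryEquiv.norm_map, h0]
  ring

/-- **Quadratic growth of `F_A`**: `|F_A(x,v)| ≤ (15 + 12√2)A(1 + ‖v‖²)` for `A ≥ 0`. [folklore] -/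
theorem abs_FA_le {A : ℝ} (hA : 0 ≤ A) (v : V3) :
    |A * (‖v‖ ^ 2 - 15 + 12 * Real.sqrt 2 * Real.exp (-(1 / 2) * (v 0) ^ 2))| ≤
      (15 + 12 * Real.sqrt 2) * A * (1 + ‖v‖ ^ 2) := by
  have he0 : 0 < Real.exp (-(1 / 2) * (v 0) ^ 2) := Real.exp_pos _
  have he1 : Real.exp (-(1 / 2) * (v 0) ^ 2) ≤ 1 := by
    rw [Real.exp_le_one_iff]; nlinarith [sq_nonneg (v 0)]
  have hs : 0 ≤ Real.sqrt 2 := Real.sqrt_nonneg _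
  have hn : 0 ≤ ‖v‖ ^ 2 := sq_nonneg _
  have hin : |‖v‖ ^ 2 - 15 + 12 * Real.sqrt 2 * Real.exp (-(1 / 2) * (v 0) ^ 2)| ≤
      (15 + 12 * Real.sqrt 2) * (1 + ‖v‖ ^ 2) := by
    rw [abs_le]
    constructor <;> nlinarith [mul_nonneg hs he0.le, mul_nonneg hs hn]
  rw [abs_mul, abs_of_nonneg hA]
  calc A * |‖v‖ ^ 2 - 15 + 12 * Real.sqrt 2 * Real.exp (-(1 / 2) * (v 0) ^ 2)|
      ≤ A * ((15 + 12 * Real.sqrt 2) * (1 + ‖v‖ ^ 2)) := mul_le_mul_of_nonneg_left hin hA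
    _ = (15 + 12 * Real.sqrt 2) * A * (1 + ‖v‖ ^ 2) := by ring

/-- **`F_A` dominates the kinetic energy**: `A(‖v‖² − 15) ≤ F_A(x,v)` for `A ≥ 0`. [folklore] -/
theorem affine_le_FA {A : ℝ} (hA : 0 ≤ A) (v : V3) :
    -15 * A + A * ‖v‖ ^ 2 ≤ A * (‖v‖ ^ 2 - 15 + 12 * Real.sqrt 2 * Real.exp (-(1 / 2) * (v 0) ^ 2)) := by
  have he0 : 0 < Real.exp (-(1 / 2) * (v 0) ^ 2) := Real.exp_pos _
  have hs : 0 ≤ Real.sqrt 2 := Real.sqrt_nonneg _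
  nlinarith [mul_nonneg (mul_nonneg hA hs) he0.le]

/-! ## The window moment of `F_A` is `+∞` for `βA ≥ ½` -/

/-- **Window sums of `F_A` dominate the conserved energy sum**: on the good set, for `w > 0` and `A ≥ 0`,
`Σᵢ (−15A + A‖vᵢ(0)‖²) ≤ Σᵢ w⁻¹∫₀ʷ F_A(Φ_r z i) dr`. [folklore] -/
theorem sum_affine_le_windowSum_FA {σ : ℝ} {N : ℕ}
    (Φ : HardSphereFlow (Torus.geometry (Fin 3)) (hsDiameter σ N) (N + 1))
    {z : Config (N + 1) (Fin 3) T3} (hz : z ∈ Φ.good) {A : ℝ} (hA : 0 ≤ A) {w : ℝ} (hw : 0 < w) :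
    ∑ i, (-15 * A + A * ‖(z i).2‖ ^ 2) ≤
      ∑ i, w⁻¹ * ∫ r in (0 : ℝ)..w,
        A * (‖(Φ.flow r z i).2‖ ^ 2 - 15 + 12 * Real.sqrt 2 * Real.exp (-(1 / 2) * ((Φ.flow r z i).2 0) ^ 2)) := by
  rw [← windowSum_affine_normSq_eq Φ hz (-15 * A) A hw]
  refine Finset.sum_le_sum fun i _ => mul_le_mul_of_nonneg_left ?_ (inv_nonneg.2 hw.le)
  refine intervalIntegral.integral_mono_on hw.le ?_ ?_ fun r _ => affine_le_FA hA _
  · exact intervalIntegrable_const.add ((intervalIntegrable_normSq_vel_flow Φ hz i 0 w).const_mul A)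
  · have hH : Measurable fun u : Config (N + 1) (Fin 3) T3 =>
        A * (‖(u i).2‖ ^ 2 - 15 + 12 * Real.sqrt 2 * Real.exp (-(1 / 2) * ((u i).2 0) ^ 2)) := by
      have h1 : Measurable fun u : Config (N + 1) (Fin 3) T3 => (u i).2 := (measurable_pi_apply i).snd
      have h2 : Measurable fun u : Config (N + 1) (Fin 3) T3 => (u i).2 0 :=
        (EuclideanSpace.proj (𝕜 := ℝ) (0 : Fin 3)).continuous.measurable.comp h1
      fun_prop
    refine intervalIntegrable_comp_flow_of_abs_le Φ hz hH
      (C := (15 + 12 * Real.sqrt 2) * A * (1 + 2 * configEnergy z)) (fun r => ?_) 0 w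
    refine (abs_FA_le hA _).trans (mul_le_mul_of_nonneg_left ?_ (by positivity))
    linarith [norm_vel_flow_sq_le Φ hz r i]

/-- **(b.2) The window exponential moment of the admissible `F_A` is `+∞` for `βA ≥ ½`** — at every `σ ≤ 1/2`,
every flow, every window `w > 0`, every `N` (`a₀ > 0`, `θ₀ = 1`, `u₀ = 0`). [folklore] -/
theorem windowMoment_FA_eq_top {a₀ : ℝ} (ha : 0 < a₀) {σ : ℝ} (hσ2 : σ ≤ 1 / 2) (N : ℕ)
    (Φ : HardSphereFlow (Torus.geometry (Fin 3)) (hsDiameter σ N) (N + 1)) {A β : ℝ} (hA : 0 < A) (hβ : 0 < β)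
    (hβA : 1 ≤ 2 * (β * A)) {w : ℝ} (hw : 0 < w) :
    ∫⁻ z, ENNReal.ofReal (Real.exp (β * ∑ i : Fin (N + 1), w⁻¹ * ∫ r in (0 : ℝ)..w,
        A * (‖(Φ.flow r z i).2‖ ^ 2 - 15 + 12 * Real.sqrt 2 * Real.exp (-(1 / 2) * ((Φ.flow r z i).2 0) ^ 2))))
        ∂(localGibbsLaw σ (fun _ => a₀) (fun _ => 0) (fun _ => 1) N Φ) = ∞ := by
  set μ := localGibbsLaw σ (fun _ => a₀) (fun _ => 0) (fun _ => 1) N Φ with hμ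
  have hae : ∀ᵐ z ∂μ, z ∈ Φ.good := mem_ae_iff.2 (localGibbsLaw_const_compl_good σ a₀ 1 0 N Φ)
  -- lower bound by the conserved affine energy observable
  have hmono : ∫⁻ z, ENNReal.ofReal (Real.exp (∑ i : Fin (N + 1),
      (fun v : V3 => β * (-15 * A + A * ‖v‖ ^ 2)) (z i).2)) ∂μ ≤
      ∫⁻ z, ENNReal.ofReal (Real.exp (β * ∑ i : Fin (N + 1), w⁻¹ * ∫ r in (0 : ℝ)..w,
        A * (‖(Φ.flow r z i).2‖ ^ 2 - 15 + 12 * Real.sqrt 2 *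
          Real.exp (-(1 / 2) * ((Φ.flow r z i).2 0) ^ 2)))) ∂μ := by
    refine lintegral_mono_ae ?_
    filter_upwards [hae] with z hz
    refine ENNReal.ofReal_le_ofReal (Real.exp_le_exp.2 ?_)
    rw [← Finset.mul_sum]
    exact mul_le_mul_of_nonneg_left (sum_affine_le_windowSum_FA Φ hz hA.le hw) hβ.le
  refine eq_top_iff.2 (le_trans ?_ hmono)
  rw [hμ, localGibbsLaw_eq, lintegral_exp_sum_vel_localGibbsMeasure ha one_pos (0 : V3) hσ2 N
    (by fun_prop : Measurable fun v : V3 => β * (-15 * A + A * ‖v‖ ^ 2)), gaussMeasure_zero_one]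
  have hpt : ∀ v : V3, ENNReal.ofReal (Real.exp (β * (-15 * A + A * ‖v‖ ^ 2))) =
      ENNReal.ofReal (Real.exp (-(15 * (β * A)))) * ENNReal.ofReal (Real.exp ((β * A) * ‖v‖ ^ 2)) := by
    intro v
    rw [← ENNReal.ofReal_mul (Real.exp_pos _).le, ← Real.exp_add]
    congr 2; ring
  simp_rw [hpt]
  rw [lintegral_const_mul _ (by fun_prop), lintegral_exp_mul_normSq_stdGaussian_eq_top hβA,
    ENNReal.mul_top (ENNReal.ofReal_pos.2 (Real.exp_pos _)).ne', ENNReal.top_pow (Nat.succ_ne_zero N)]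

/-- **The β-ceiling**: if the window moment of `F_A` at a tilt `β > 0` is finite for SOME window, flow and `N`,
then `β < 1/(2A)`. [folklore] -/
theorem two_mul_beta_mul_lt_one_of_windowMoment_ne_top {a₀ : ℝ} (ha : 0 < a₀) {σ : ℝ} (hσ2 : σ ≤ 1 / 2)
    {N : ℕ} (Φ : HardSphereFlow (Torus.geometry (Fin 3)) (hsDiameter σ N) (N + 1)) {A β : ℝ} (hA : 0 < A)
    (hβ : 0 < β) {w : ℝ} (hw : 0 < w)
    (hfin : ∫⁻ z, ENNReal.ofReal (Real.exp (β * ∑ i : Fin (N + 1), w⁻¹ * ∫ r in (0 : ℝ)..w,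
        A * (‖(Φ.flow r z i).2‖ ^ 2 - 15 + 12 * Real.sqrt 2 * Real.exp (-(1 / 2) * ((Φ.flow r z i).2 0) ^ 2))))
        ∂(localGibbsLaw σ (fun _ => a₀) (fun _ => 0) (fun _ => 1) N Φ) ≠ ∞) :
    2 * (β * A) < 1 := by
  by_contra h
  exact hfin (windowMoment_FA_eq_top ha hσ2 N Φ hA hβ (not_lt.1 h) hw)


end BetaCeiling

/-! ## (c.2) no tilt range uniform in `F` (to land as `Negative/UniformBeta.lean`) -/


/-- `TwoClocks.EquilibriumFastWindowLD` with `∃ β₀ > 0` moved in front of `∀ F` (tilt range uniform over the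
admissible observables); all other tokens verbatim. A variant statement refuted below, not a fact. -/
def EquilibriumFastWindowLDUniformBeta : Prop :=
  ∃ σ₀ : ℝ, 0 < σ₀ ∧ ∀ (a₀ θ₀ : ℝ) (u₀ : V3), 0 < a₀ → 0 < θ₀ → ∀ σ : ℝ, 0 < σ → σ < σ₀ →
    ∀ Φ : (N : ℕ) → HardSphereFlow (Torus.geometry (Fin 3)) (hsDiameter σ N) (N + 1),
    ∃ β₀ : ℝ, 0 < β₀ ∧ ∀ F : T3 × V3 → ℝ, Continuous F → (∃ C : ℝ, ∀ y, |F y| ≤ C * (1 + ‖y.2‖ ^ 2)) →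
    (∀ x, ∫ v, F (x, v) * localMaxwellian 1 θ₀ u₀ v = 0) →
    (∀ x (j : Fin 3), ∫ v, F (x, v) * v j * localMaxwellian 1 θ₀ u₀ v = 0) →
    (∀ x, ∫ v, F (x, v) * ‖v‖ ^ 2 * localMaxwellian 1 θ₀ u₀ v = 0) →
    ∀ β : ℝ, |β| ≤ β₀ → ∀ ε : ℝ, 0 < ε → ∃ τ : ℝ, 0 < τ ∧ ∃ N₀ : ℕ,
      ∀ N : ℕ, N₀ ≤ N →
        ∫⁻ z, ENNReal.ofReal (Real.exp (β * ∑ i : Fin (N + 1),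
            (τ * ((N : ℝ) + 1) ^ (-(1 / 3 : ℝ)))⁻¹ *
              ∫ r in (0 : ℝ)..(τ * ((N : ℝ) + 1) ^ (-(1 / 3 : ℝ))), F (((Φ N).flow r z) i)))
          ∂(localGibbsLaw σ (fun _ => a₀) (fun _ => u₀) (fun _ => θ₀) N (Φ N)) ≤
        ENNReal.ofReal (Real.exp (ε * ((N : ℝ) + 1)))

/-- **(c.2) The tilt range cannot be chosen uniformly in `F`.** [folklore] -/
theorem equilibriumFastWindowLD_false_uniformBeta : ¬ EquilibriumFastWindowLDUniformBeta := by
  rintro ⟨σ₀, hσ₀, h⟩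
  set σ : ℝ := min (σ₀ / 2) (1 / 4) with hσdef
  have hσpos : 0 < σ := lt_min (by linarith) (by norm_num)
  have hσlt : σ < σ₀ := (min_le_left _ _).trans_lt (by linarith)
  have hσ2 : σ ≤ 1 / 2 := (min_le_right _ _).trans (by norm_num)
  have hσhalf : σ < 2⁻¹ := (min_le_right _ _).trans_lt (by norm_num)
  set Φ : (N : ℕ) → HardSphereFlow (Torus.geometry (Fin 3)) (hsDiameter σ N) (N + 1) :=
    fun N => Classical.choice (nonempty_flow hσpos hσhalf N) with hΦdef
  obtain ⟨β₀, hβ₀, hβ⟩ := h 1 1 0 one_pos one_pos σ hσpos hσlt Φ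
  -- the admissible witness `F_A`, `A = 1/(2β₀)`
  set A : ℝ := (2 * β₀)⁻¹ with hAdef
  have hA : 0 < A := by rw [hAdef]; positivity
  have hβA : 1 ≤ 2 * (β₀ * A) := by
    rw [hAdef, ← mul_assoc, mul_inv_cancel₀ (by positivity : (2 : ℝ) * β₀ ≠ 0)]
  set F : T3 × V3 → ℝ := fun y =>
    A * (‖y.2‖ ^ 2 - 15 + 12 * Real.sqrt 2 * Real.exp (-(1 / 2) * (y.2 0) ^ 2)) with hFdef
  have hFc : Continuous F := by rw [hFdef]; fun_prop
  have hFg : ∃ C : ℝ, ∀ y, |F y| ≤ C * (1 + ‖y.2‖ ^ 2) :=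
    ⟨(15 + 12 * Real.sqrt 2) * A, fun y => by rw [hFdef]; exact abs_FA_le hA.le y.2⟩
  have hF1 : ∀ x : T3, ∫ v, F (x, v) * localMaxwellian 1 1 (0 : V3) v = 0 := fun x => by
    simp only [hFdef]; exact integral_FA_mul_localMaxwellian A
  have hFv : ∀ (x : T3) (j : Fin 3), ∫ v, F (x, v) * v j * localMaxwellian 1 1 (0 : V3) v = 0 := fun x j => by
    simp only [hFdef]; exact integral_FA_mul_coord_mul_localMaxwellian A j
  have hFE : ∀ x : T3, ∫ v, F (x, v) * ‖v‖ ^ 2 * localMaxwellian 1 1 (0 : V3) v = 0 := fun x => by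
    simp only [hFdef]; exact integral_FA_mul_normSq_mul_localMaxwellian A
  obtain ⟨τ, hτ, N₀, hN⟩ := hβ F hFc hFg hF1 hFv hFE β₀ (abs_of_pos hβ₀).le 1 one_pos
  have hw : 0 < τ * ((N₀ : ℝ) + 1) ^ (-(1 / 3 : ℝ)) := mul_pos hτ (Real.rpow_pos_of_pos (by positivity) _)
  have h0 := hN N₀ le_rfl
  simp only [hFdef] at h0
  rw [windowMoment_FA_eq_top one_pos hσ2 N₀ (Φ N₀) hA hβ₀ hβA hw, top_le_iff] at h0
  exact ENNReal.ofReal_ne_top h0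


/-! ## (b.3) the energy-shell floor (to land as `Negative/ShellFloor.lean`) -/


/-! ## One-body velocity marginals of the global Gibbs law -/

/-- **One-body velocity marginal, `lintegral` form**: under the constant-profile Gibbs law the velocity of particle
`i` is `N(u, θ·id)`: `∫⁻ f(vᵢ) dG_N = ∫⁻ f dN(u,θ)` (disintegration `lintegral_localGibbsMeasure`). [folklore] -/
theorem lintegral_vel_localGibbsLaw_const {a θ : ℝ} (ha : 0 < a) (hθ : 0 < θ) (u : V3) {σ : ℝ} (hσ2 : σ ≤ 1 / 2)
    (N : ℕ) (Φ : HardSphereFlow (Torus.geometry (Fin 3)) (hsDiameter σ N) (N + 1)) (i : Fin (N + 1))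
    {f : V3 → ℝ≥0∞} (hf : Measurable f) :
    ∫⁻ z, f (z i).2 ∂(localGibbsLaw σ (fun _ => a) (fun _ => u) (fun _ => θ) N Φ) = ∫⁻ w, f w ∂(gaussMeasure u θ) := by
  haveI := isProbabilityMeasure_localGibbsMeasure (a₀ := fun _ => a) (u₀ := fun _ => u) (θ₀ := fun _ => θ)
    continuous_const continuous_const continuous_const (fun _ => ha) (fun _ => hθ) hσ2 N
  have hG : Measurable fun z : Config (N + 1) (Fin 3) T3 => f (z i).2 := hf.comp (measurable_pi_apply i).snd
  rw [localGibbsLaw_eq, lintegral_localGibbsMeasure continuous_const continuous_const continuous_const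
    (fun _ => ha.le) (fun _ => hθ) σ N hG]
  have hinner : ∀ x : Fin (N + 1) → T3,
      ∫⁻ v, f (zipConfig (x, v) i).2 ∂velMeasure (fun _ => u) (fun _ => θ) x = ∫⁻ w, f w ∂(gaussMeasure u θ) := by
    intro x
    simp only [zipConfig_apply]
    exact (measurePreserving_eval (fun _ : Fin (N + 1) => gaussMeasure u θ) i).lintegral_comp hf
  simp_rw [hinner]
  rw [lintegral_mul_const _ (by
      exact (measurable_const.mul (measurable_posWeight continuous_const _ _)).ennreal_ofReal),
    lintegral_posWeight_eq_one continuous_const continuous_const continuous_const (fun _ => ha.le)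
      (fun _ => hθ) σ N, one_mul]

/-- A velocity observable of quadratic growth is integrable under the constant-profile Gibbs law. [folklore] -/
theorem integrable_vel_localGibbsLaw_const {a θ : ℝ} (ha : 0 < a) (hθ : 0 < θ) (u : V3) {σ : ℝ} (hσ2 : σ ≤ 1 / 2)
    (N : ℕ) (Φ : HardSphereFlow (Torus.geometry (Fin 3)) (hsDiameter σ N) (N + 1)) (i : Fin (N + 1))
    {g : V3 → ℝ} (hg : Measurable g) {C : ℝ} (hC : ∀ v, |g v| ≤ C * (1 + ‖v‖ ^ 2)) :
    Integrable (fun z : Config (N + 1) (Fin 3) T3 => g (z i).2)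
      (localGibbsLaw σ (fun _ => a) (fun _ => u) (fun _ => θ) N Φ) := by
  haveI : IsProbabilityMeasure (localGibbsLaw σ (fun _ => a) (fun _ => u) (fun _ => θ) N Φ) :=
    isProbabilityMeasure_localGibbsLaw (a₀ := fun _ => a) (θ₀ := fun _ => θ) (u₀ := fun _ => u)
      continuous_const continuous_const continuous_const (fun _ => ha) (fun _ => hθ) hσ2 N Φ
  have hC0 : 0 ≤ C := growthConst_nonneg (F := fun y : T3 × V3 => g y.2) (fun y => hC y.2)
  have hdom : Integrable (fun z : Config (N + 1) (Fin 3) T3 => C * (1 + 2 * configEnergy z))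
      (localGibbsLaw σ (fun _ => a) (fun _ => u) (fun _ => θ) N Φ) :=
    ((integrable_const (1 : ℝ)).add
      ((integrable_configEnergy_localGibbsLaw_const ha hθ u hσ2 N Φ).const_mul 2)).const_mul C
  refine hdom.mono' (hg.comp (measurable_pi_apply i).snd).aestronglyMeasurable (ae_of_all _ fun z => ?_)
  rw [Real.norm_eq_abs]
  refine (hC _).trans (mul_le_mul_of_nonneg_left ?_ hC0)
  linarith [norm_vel_sq_le_two_mul_configEnergy z i]

/-- A velocity observable of quadratic growth is integrable under `N(u, θ·id)`. [folklore] -/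
theorem integrable_gaussMeasure_of_growth (θ : ℝ) (u : V3) {g : V3 → ℝ} (hg : Measurable g) {C : ℝ}
    (hC : ∀ v, |g v| ≤ C * (1 + ‖v‖ ^ 2)) : Integrable g (gaussMeasure u θ) := by
  have h0 : Integrable (fun v : V3 => ‖v‖ ^ 2 / 2 - 0) (gaussMeasure u θ) :=
    (memLp_energy_gaussMeasure (ι := Fin 3) u θ 0).integrable one_le_two
  have h2 : Integrable (fun v : V3 => ‖v‖ ^ 2) (gaussMeasure u θ) :=
    (h0.const_mul 2).congr (ae_of_all _ fun v => by simp only [sub_zero]; ring)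
  refine (((integrable_const (1 : ℝ)).add h2).const_mul C).mono' hg.aestronglyMeasurable (ae_of_all _ fun v => ?_)
  rw [Real.norm_eq_abs]
  exact hC v

/-- **One-body velocity marginal, Bochner form**: for `g` measurable of quadratic growth,
`∫ g(vᵢ) dG_N = ∫ g dN(u,θ)`. [folklore] -/
theorem integral_vel_localGibbsLaw_const {a θ : ℝ} (ha : 0 < a) (hθ : 0 < θ) (u : V3) {σ : ℝ} (hσ2 : σ ≤ 1 / 2)
    (N : ℕ) (Φ : HardSphereFlow (Torus.geometry (Fin 3)) (hsDiameter σ N) (N + 1)) (i : Fin (N + 1))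
    {g : V3 → ℝ} (hg : Measurable g) {C : ℝ} (hC : ∀ v, |g v| ≤ C * (1 + ‖v‖ ^ 2)) :
    ∫ z, g (z i).2 ∂(localGibbsLaw σ (fun _ => a) (fun _ => u) (fun _ => θ) N Φ) = ∫ w, g w ∂(gaussMeasure u θ) := by
  have hI := integrable_vel_localGibbsLaw_const ha hθ u hσ2 N Φ i hg hC
  have hJ := integrable_gaussMeasure_of_growth θ u hg hC
  rw [integral_eq_lintegral_pos_part_sub_lintegral_neg_part hI,
    integral_eq_lintegral_pos_part_sub_lintegral_neg_part hJ,
    lintegral_vel_localGibbsLaw_const ha hθ u hσ2 N Φ i (f := fun w => ENNReal.ofReal (g w)) hg.ennreal_ofReal,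
    lintegral_vel_localGibbsLaw_const ha hθ u hσ2 N Φ i (f := fun w => ENNReal.ofReal (-g w)) hg.neg.ennreal_ofReal]

/-- `∫ ‖v‖² dN(0, θ·id) = 3θ` on `ℝ³`. [folklore] -/
theorem integral_normSq_gaussMeasure {θ : ℝ} (hθ : 0 < θ) : ∫ v, ‖v‖ ^ 2 ∂(gaussMeasure (0 : V3) θ) = 3 * θ := by
  rw [integral_gaussMeasure (0 : V3) hθ]
  simp only [zero_add, norm_smul, mul_pow, Real.norm_eq_abs, abs_of_nonneg (Real.sqrt_nonneg θ),
    Real.sq_sqrt hθ.le]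
  rw [integral_const_mul, integral_norm_sq_stdGaussian]
  simp
  ring

/-- **Mean kinetic energy under the Gibbs law at rest**: `∫ E dG_N = (3/2) θ (N+1)`. [folklore] -/
theorem integral_configEnergy_localGibbsLaw_const {a θ : ℝ} (ha : 0 < a) (hθ : 0 < θ) {σ : ℝ} (hσ2 : σ ≤ 1 / 2)
    (N : ℕ) (Φ : HardSphereFlow (Torus.geometry (Fin 3)) (hsDiameter σ N) (N + 1)) :
    ∫ z, configEnergy z ∂(localGibbsLaw σ (fun _ => a) (fun _ => 0) (fun _ => θ) N Φ) = 3 / 2 * θ * ((N : ℝ) + 1) := by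
  have hg : Measurable fun v : V3 => ‖v‖ ^ 2 := measurable_norm.pow_const 2
  have hC : ∀ v : V3, |‖v‖ ^ 2| ≤ 1 * (1 + ‖v‖ ^ 2) := fun v => by
    rw [abs_of_nonneg (sq_nonneg _)]; linarith
  have hi : ∀ i : Fin (N + 1), ∫ z, ‖(z i).2‖ ^ 2 ∂(localGibbsLaw σ (fun _ => a) (fun _ => 0) (fun _ => θ) N Φ) =
      3 * θ := fun i => by
    rw [integral_vel_localGibbsLaw_const ha hθ 0 hσ2 N Φ i hg hC, integral_normSq_gaussMeasure hθ]
  simp only [configEnergy]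
  rw [integral_const_mul, integral_finsetSum _ (fun i _ =>
    integrable_vel_localGibbsLaw_const ha hθ 0 hσ2 N Φ i hg hC)]
  simp_rw [hi]
  simp [Finset.sum_const, Finset.card_univ, Fintype.card_fin]
  ring

/-! ## Change of the reference temperature -/

/-- The velocity factors of the constant-profile Gibbs densities at temperatures `θ` and `1` differ by
`θ^{-3n/2} e^{-(θ⁻¹-1)E}`. [folklore] -/
theorem gibbsVelFactor_temperature (a : ℝ) {θ : ℝ} (hθ : 0 < θ) (n : ℕ) (E : ℝ) :
    (a * (2 * Real.pi * θ) ^ (-(3 : ℝ) / 2)) ^ n * Real.exp (-E / θ) =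
      (a * (2 * Real.pi * 1) ^ (-(3 : ℝ) / 2)) ^ n * Real.exp (-E / 1) *
        (θ ^ (-(3 : ℝ) * (n : ℝ) / 2) * Real.exp (-(θ⁻¹ - 1) * E)) := by
  have h2π : (0 : ℝ) ≤ 2 * Real.pi := by positivity
  have hθn : (θ ^ (-(3 : ℝ) / 2)) ^ n = θ ^ (-(3 : ℝ) * (n : ℝ) / 2) := by
    rw [← Real.rpow_natCast, ← Real.rpow_mul hθ.le]
    congr 1
    ring
  have hexp : Real.exp (-E / θ) = Real.exp (-E / 1) * Real.exp (-(θ⁻¹ - 1) * E) := by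
    rw [← Real.exp_add]
    congr 1
    field_simp
    ring
  rw [mul_one, Real.mul_rpow h2π hθ.le, ← mul_assoc a, mul_pow, hθn, hexp]
  ring

/-- **The Gibbs law at temperature `θ` has density `θ^{-3(N+1)/2} e^{-(θ⁻¹ - 1)E}` w.r.t. the one at temperature `1`**
(same activity, at rest; the positions factor and the partition function coincide,
`canonicalPartition_eq_posPartition`). [folklore] -/
theorem localGibbsLaw_temperature_eq_withDensity {a θ : ℝ} (ha : 0 < a) (hθ : 0 < θ) {σ : ℝ} (N : ℕ)
    (Φ : HardSphereFlow (Torus.geometry (Fin 3)) (hsDiameter σ N) (N + 1)) :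
    localGibbsLaw σ (fun _ => a) (fun _ => 0) (fun _ => θ) N Φ =
      (localGibbsLaw σ (fun _ => a) (fun _ => 0) (fun _ => 1) N Φ).withDensity fun z =>
        ENNReal.ofReal (θ ^ (-(3 : ℝ) * ((N : ℝ) + 1) / 2) * Real.exp (-(θ⁻¹ - 1) * configEnergy z)) := by
  set L := liouville (Torus.geometry (Fin 3)) (N + 1) (hsDiameter σ N) with hL
  set ρ : ℝ → Config (N + 1) (Fin 3) T3 → ℝ := fun t z => canonicalDensity (Torus.geometry (Fin 3)) (hsDiameter σ N)
    (N + 1) (localGibbsProfile (fun _ => a) (fun _ => (0 : V3)) (fun _ => t)) z with hρ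
  set r : Config (N + 1) (Fin 3) T3 → ℝ := fun z =>
    θ ^ (-(3 : ℝ) * ((N : ℝ) + 1) / 2) * Real.exp (-(θ⁻¹ - 1) * configEnergy z) with hr
  have hG : ∀ t : ℝ, localGibbsLaw σ (fun _ => a) (fun _ => 0) (fun _ => t) N Φ =
      L.withDensity (fun z => ENNReal.ofReal (ρ t z)) := fun t => rfl
  have hρm : ∀ t : ℝ, Measurable fun z => ENNReal.ofReal (ρ t z) := fun t =>
    (measurable_canonicalDensity _ _ (measurable_localGibbsProfile continuous_const continuous_const
      continuous_const)).ennreal_ofReal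
  have hrm : Measurable fun z => ENNReal.ofReal (r z) := by
    have := measurable_configEnergy (N + 1)
    simp only [hr]
    fun_prop
  -- the two partition functions coincide
  have hZ : ∀ t : ℝ, 0 < t → canonicalPartition (Torus.geometry (Fin 3)) (hsDiameter σ N) (N + 1)
      (localGibbsProfile (fun _ => a) (fun _ => (0 : V3)) (fun _ => t)) = posPartition (fun _ => a) (hsDiameter σ N) (N + 1) :=
    fun t ht => canonicalPartition_eq_posPartition continuous_const continuous_const continuous_const
      (fun _ => ha.le) (fun _ => ht) _ _
  -- pointwise identity of the densities
  have hpt : ∀ z, ρ θ z = ρ 1 z * r z := by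
    intro z
    show canonicalDensity _ _ _ _ z = canonicalDensity _ _ _ _ z * r z
    unfold canonicalDensity
    rw [hZ θ hθ, hZ 1 one_pos]
    by_cases hz : z ∈ hardSphereDomain (Torus.geometry (Fin 3)) (N + 1) (hsDiameter σ N)
    · rw [indicator_of_mem hz, indicator_of_mem hz, CorrectorPressureDecayNegative.tensorPow_localGibbsProfile_const,
        CorrectorPressureDecayNegative.tensorPow_localGibbsProfile_const,
        gibbsVelFactor_temperature a hθ (N + 1) (configEnergy z), hr]
      push_cast
      ring
    · rw [indicator_of_notMem hz, indicator_of_notMem hz]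
      simp
  have hρ1 : ∀ z, 0 ≤ ρ 1 z := fun z => by
    show 0 ≤ canonicalDensity _ _ _ _ z
    unfold canonicalDensity
    refine mul_nonneg (inv_nonneg.2 (canonicalPartition_nonneg _ _ _
      (localGibbsProfile_nonneg (fun _ => ha.le) fun _ => zero_le_one))) ?_
    exact Set.indicator_nonneg (fun w _ => tensorPow_nonneg
      (localGibbsProfile_nonneg (fun _ => ha.le) fun _ => zero_le_one) _ w) z
  rw [hG θ, hG 1, ← withDensity_mul _ (hρm 1) hrm]
  congr 1
  funext z
  rw [Pi.mul_apply, hpt z, ENNReal.ofReal_mul (hρ1 z)]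

/-- **Exponential moments at temperature `1` are temperature-`θ` moments of the re-weighted observable**:
`∫⁻ e^{Y} dG_N^{(1)} = θ^{3(N+1)/2} ∫⁻ e^{Y + (θ⁻¹ - 1)E} dG_N^{(θ)}`. [folklore] -/
theorem lintegral_exp_eq_temperature {a θ : ℝ} (ha : 0 < a) (hθ : 0 < θ) {σ : ℝ} (N : ℕ)
    (Φ : HardSphereFlow (Torus.geometry (Fin 3)) (hsDiameter σ N) (N + 1)) (Y : Config (N + 1) (Fin 3) T3 → ℝ) :
    ∫⁻ z, ENNReal.ofReal (Real.exp (Y z)) ∂(localGibbsLaw σ (fun _ => a) (fun _ => 0) (fun _ => 1) N Φ) =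
      ENNReal.ofReal (θ ^ ((3 : ℝ) * ((N : ℝ) + 1) / 2)) *
        ∫⁻ z, ENNReal.ofReal (Real.exp (Y z + (θ⁻¹ - 1) * configEnergy z))
          ∂(localGibbsLaw σ (fun _ => a) (fun _ => 0) (fun _ => θ) N Φ) := by
  have hrm : Measurable fun z : Config (N + 1) (Fin 3) T3 =>
      ENNReal.ofReal (θ ^ (-(3 : ℝ) * ((N : ℝ) + 1) / 2) * Real.exp (-(θ⁻¹ - 1) * configEnergy z)) := by
    have := measurable_configEnergy (N + 1)
    fun_prop
  rw [localGibbsLaw_temperature_eq_withDensity ha hθ N Φ, ← lintegral_const_mul' _ _ ENNReal.ofReal_ne_top,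
    lintegral_withDensity_eq_lintegral_mul_non_measurable _ hrm (ae_of_all _ fun _ => ENNReal.ofReal_lt_top)]
  refine lintegral_congr fun z => ?_
  have hθp : 0 < θ ^ ((3 : ℝ) * ((N : ℝ) + 1) / 2) := Real.rpow_pos_of_pos hθ _
  simp only [Pi.mul_apply]
  rw [← ENNReal.ofReal_mul hθp.le, ← ENNReal.ofReal_mul (by positivity)]
  congr 1
  rw [Real.exp_add, show ∀ p e3 q e1 e2 : ℝ, p * e3 * (q * (e1 * e2)) = (p * q) * (e1 * (e2 * e3)) from
    fun _ _ _ _ _ => by ring, ← Real.rpow_add hθ, ← Real.exp_add, ← Real.exp_add]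
  have h0 : -(3 : ℝ) * ((N : ℝ) + 1) / 2 + 3 * ((N : ℝ) + 1) / 2 = 0 := by ring
  rw [h0, Real.rpow_zero, one_mul]
  congr 1
  ring

/-! ## The window functional of a velocity observable: integrability and mean under `G_N^{(θ)}` -/

/-- **The window functional is integrable and has the static mean**: for `g` continuous of quadratic growth, under
the Gibbs law at rest at temperature `θ`, `z ↦ Σᵢ w⁻¹∫₀ʷ g(vᵢ(r)) dr` is integrable with integral
`(N+1) ∫ g dN(0,θ)`. [folklore] -/
theorem integrable_windowSum_and_integral_eq {a θ : ℝ} (ha : 0 < a) (hθ : 0 < θ) {σ : ℝ} (hσ2 : σ ≤ 1 / 2) (N : ℕ)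
    (Φ : HardSphereFlow (Torus.geometry (Fin 3)) (hsDiameter σ N) (N + 1)) {g : V3 → ℝ} (hg : Continuous g) {C : ℝ}
    (hC : ∀ v, |g v| ≤ C * (1 + ‖v‖ ^ 2)) {w : ℝ} (hw : 0 < w) :
    Integrable (fun z : Config (N + 1) (Fin 3) T3 => ∑ i, w⁻¹ * ∫ r in (0 : ℝ)..w, g (Φ.flow r z i).2)
      (localGibbsLaw σ (fun _ => a) (fun _ => 0) (fun _ => θ) N Φ) ∧
    ∫ z, (∑ i, w⁻¹ * ∫ r in (0 : ℝ)..w, g (Φ.flow r z i).2)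
      ∂(localGibbsLaw σ (fun _ => a) (fun _ => 0) (fun _ => θ) N Φ) = ((N : ℝ) + 1) * ∫ v, g v ∂(gaussMeasure (0 : V3) θ) := by
  set μ := localGibbsLaw σ (fun _ => a) (fun _ => 0) (fun _ => θ) N Φ with hμ
  haveI : IsProbabilityMeasure μ := isProbabilityMeasure_localGibbsLaw (a₀ := fun _ => a)
    (θ₀ := fun _ => θ) (u₀ := fun _ => (0 : V3)) continuous_const continuous_const continuous_const
    (fun _ => ha) (fun _ => hθ) hσ2 N Φ
  have hF : Continuous fun y : T3 × V3 => g y.2 := hg.comp continuous_snd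
  have hCF : ∀ y : T3 × V3, |g y.2| ≤ C * (1 + ‖y.2‖ ^ 2) := fun y => hC y.2
  have hC0 : 0 ≤ C := growthConst_nonneg hCF
  have hae : ∀ᵐ z ∂μ, z ∈ Φ.good := mem_ae_iff.2 (localGibbsLaw_const_compl_good σ a θ 0 N Φ)
  -- each window integral is bounded by the integrable `w C (1 + 2E)` on the good set, and measurable
  have hint : ∀ i : Fin (N + 1), Integrable (fun z => w⁻¹ * ∫ r in (0 : ℝ)..w, g (Φ.flow r z i).2) μ := by
    intro i
    have hdom : Integrable (fun z : Config (N + 1) (Fin 3) T3 => w⁻¹ * (w * (C * (1 + 2 * configEnergy z)))) μ :=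
      ((((integrable_const (1 : ℝ)).add
        ((integrable_configEnergy_localGibbsLaw_const ha hθ 0 hσ2 N Φ).const_mul 2)).const_mul C).const_mul
        w).const_mul w⁻¹
    -- measurability: the window integral is the `ν`-integral of a jointly a.e.-measurable, integrable map
    set ν : Measure ℝ := volume.restrict (Ioc (0 : ℝ) w) with hν
    haveI : IsFiniteMeasure ν := by rw [hν]; exact isFiniteMeasure_restrict.2 (by simp)
    have hgi : Measurable fun z : Config (N + 1) (Fin 3) T3 => g (z i).2 :=
      hg.measurable.comp (measurable_pi_apply i).snd
    have hm : AEStronglyMeasurable (Function.uncurry fun (z : Config (N + 1) (Fin 3) T3) (r : ℝ) =>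
        g (Φ.flow r z i).2) (μ.prod ν) :=
      (aemeasurable_comp_flow_prod Φ (localGibbsLaw_const_compl_good σ a θ 0 N Φ) ν (0 : ℝ) hgi).aestronglyMeasurable
    have hdomP : Integrable (fun p : Config (N + 1) (Fin 3) T3 × ℝ => C * (1 + 2 * configEnergy p.1)) (μ.prod ν) :=
      (((integrable_const (1 : ℝ)).add
        ((integrable_configEnergy_localGibbsLaw_const ha hθ 0 hσ2 N Φ).const_mul 2)).const_mul C).comp_fst ν
    have haeP : ∀ᵐ p ∂(μ.prod ν), p.1 ∈ Φ.good := (Measure.quasiMeasurePreserving_fst (μ := μ) (ν := ν)).ae hae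
    have hintP : Integrable (Function.uncurry fun (z : Config (N + 1) (Fin 3) T3) (r : ℝ) => g (Φ.flow r z i).2)
        (μ.prod ν) := by
      refine hdomP.mono' hm ?_
      filter_upwards [haeP] with p hp
      change ‖g (Φ.flow p.2 p.1 i).2‖ ≤ _
      rw [Real.norm_eq_abs]
      refine (hC _).trans (mul_le_mul_of_nonneg_left ?_ hC0)
      linarith [norm_vel_flow_sq_le Φ hp p.2 i]
    have hmeas : AEStronglyMeasurable (fun z => w⁻¹ * ∫ r in (0 : ℝ)..w, g (Φ.flow r z i).2) μ := by
      have h1 : AEStronglyMeasurable (fun z => ∫ r, g (Φ.flow r z i).2 ∂ν) μ :=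
        hintP.integral_prod_left.aestronglyMeasurable
      have h2 : (fun z => w⁻¹ * ∫ r in (0 : ℝ)..w, g (Φ.flow r z i).2) =
          fun z => w⁻¹ * ∫ r, g (Φ.flow r z i).2 ∂ν := by
        funext z; rw [intervalIntegral.integral_of_le hw.le, hν]
      rw [h2]
      exact h1.const_mul _
    refine hdom.mono' hmeas ?_
    filter_upwards [hae] with z hz
    rw [Real.norm_eq_abs, abs_mul, abs_of_pos (inv_pos.2 hw)]
    exact mul_le_mul_of_nonneg_left (abs_window_integral_le Φ hz hCF hw.le i) (inv_nonneg.2 hw.le)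
  refine ⟨integrable_finsetSum _ fun i _ => hint i, ?_⟩
  rw [integral_finsetSum _ fun i _ => hint i]
  have hi : ∀ i : Fin (N + 1), ∫ z, (w⁻¹ * ∫ r in (0 : ℝ)..w, g (Φ.flow r z i).2) ∂μ =
      ∫ v, g v ∂(gaussMeasure (0 : V3) θ) := by
    intro i
    rw [integral_const_mul]
    have h := integral_window_integral_eq ha hθ 0 hσ2 N Φ hF hCF i hw.le
    rw [hμ, h, ← mul_assoc, inv_mul_cancel₀ hw.ne', one_mul,
      integral_vel_localGibbsLaw_const ha hθ 0 hσ2 N Φ i hg.measurable hC]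
  simp_rw [hi]
  simp [Finset.sum_const, Finset.card_univ, Fintype.card_fin]

/-! ## The shell floor -/

/-- **(b.3) The energy-shell floor of the window pressure.** For the global Gibbs law at rest with `θ₀ = 1`
(`a₀ > 0`, `σ ≤ 1/2`), every flow, window `w > 0`, `N`, tilt `β`, continuous `g` of quadratic growth and every
temperature `θ > 0`:
`exp((N+1)[β ∫ g dN(0,θ) − (3/2)(θ − 1 − log θ)]) ≤ ∫ exp(β Σᵢ w⁻¹∫₀ʷ g(vᵢ(r)) dr) dG_N`. [folklore] -/
theorem shellFloor {a₀ : ℝ} (ha : 0 < a₀) {σ : ℝ} (hσ2 : σ ≤ 1 / 2) (N : ℕ)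
    (Φ : HardSphereFlow (Torus.geometry (Fin 3)) (hsDiameter σ N) (N + 1)) {g : V3 → ℝ} (hg : Continuous g) {C : ℝ}
    (hC : ∀ v, |g v| ≤ C * (1 + ‖v‖ ^ 2)) (β : ℝ) {θ : ℝ} (hθ : 0 < θ) {w : ℝ} (hw : 0 < w) :
    ENNReal.ofReal (Real.exp (((N : ℝ) + 1) *
        (β * ∫ v, g v ∂(gaussMeasure (0 : V3) θ) - 3 / 2 * (θ - 1 - Real.log θ)))) ≤
      ∫⁻ z, ENNReal.ofReal (Real.exp (β * ∑ i : Fin (N + 1), w⁻¹ * ∫ r in (0 : ℝ)..w, g (Φ.flow r z i).2))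
        ∂(localGibbsLaw σ (fun _ => a₀) (fun _ => 0) (fun _ => 1) N Φ) := by
  set μθ := localGibbsLaw σ (fun _ => a₀) (fun _ => 0) (fun _ => θ) N Φ with hμθ
  haveI : IsProbabilityMeasure μθ := isProbabilityMeasure_localGibbsLaw (a₀ := fun _ => a₀)
    (θ₀ := fun _ => θ) (u₀ := fun _ => (0 : V3)) continuous_const continuous_const continuous_const
    (fun _ => ha) (fun _ => hθ) hσ2 N Φ
  obtain ⟨hWint, hWmean⟩ := integrable_windowSum_and_integral_eq ha hθ hσ2 N Φ hg hC hw
  set Z : Config (N + 1) (Fin 3) T3 → ℝ := fun z =>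
    β * (∑ i : Fin (N + 1), w⁻¹ * ∫ r in (0 : ℝ)..w, g (Φ.flow r z i).2) + (θ⁻¹ - 1) * configEnergy z with hZ
  have hZint : Integrable Z μθ :=
    (hWint.const_mul β).add ((integrable_configEnergy_localGibbsLaw_const ha hθ 0 hσ2 N Φ).const_mul _)
  have hZmean : ∫ z, Z z ∂μθ = ((N : ℝ) + 1) * (β * ∫ v, g v ∂(gaussMeasure (0 : V3) θ) + 3 / 2 * (1 - θ)) := by
    rw [hZ, integral_add (hWint.const_mul β) ((integrable_configEnergy_localGibbsLaw_const ha hθ 0 hσ2 N Φ).const_mul _),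
      integral_const_mul, integral_const_mul, hWmean, integral_configEnergy_localGibbsLaw_const ha hθ hσ2 N Φ]
    have hθ0 : θ ≠ 0 := hθ.ne'
    have key : (θ⁻¹ - 1) * θ = 1 - θ := by rw [sub_mul, inv_mul_cancel₀ hθ0, one_mul]
    linear_combination (3 / 2 * ((N : ℝ) + 1)) * key
  -- change the reference temperature, then Jensen under `μθ`
  rw [lintegral_exp_eq_temperature ha hθ N Φ]
  have hJ := KineticFluxLdDecayTilt.ofReal_exp_integral_le_lintegral μθ hZint
  rw [hZmean] at hJ
  calc ENNReal.ofReal (Real.exp (((N : ℝ) + 1) * (β * ∫ v, g v ∂(gaussMeasure (0 : V3) θ) - 3 / 2 * (θ - 1 - Real.log θ))))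
      = ENNReal.ofReal (θ ^ ((3 : ℝ) * ((N : ℝ) + 1) / 2)) *
          ENNReal.ofReal (Real.exp (((N : ℝ) + 1) * (β * ∫ v, g v ∂(gaussMeasure (0 : V3) θ) + 3 / 2 * (1 - θ)))) := by
        rw [← ENNReal.ofReal_mul (Real.rpow_nonneg hθ.le _), Real.rpow_def_of_pos hθ, ← Real.exp_add]
        congr 2
        ring
    _ ≤ ENNReal.ofReal (θ ^ ((3 : ℝ) * ((N : ℝ) + 1) / 2)) * ∫⁻ z, ENNReal.ofReal (Real.exp (Z z)) ∂μθ :=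
        mul_le_mul' le_rfl hJ

/-- **(b.3′) The `(E)`-shell β-ceiling**: if the crux's conclusion holds for the velocity observable `g` (at
`θ₀ = 1`, `u₀ = 0`, some `σ ≤ 1/2`, `a₀ > 0`, some flow family) at the tilt `β`, then
`β ∫ g dN(0,θ) ≤ (3/2)(θ − 1 − log θ)` for EVERY `θ > 0`. [folklore] -/
theorem beta_mul_mean_le_relEntropy_of_windowDecay {a₀ : ℝ} (ha : 0 < a₀) {σ : ℝ} (hσ2 : σ ≤ 1 / 2)
    (Φ : (N : ℕ) → HardSphereFlow (Torus.geometry (Fin 3)) (hsDiameter σ N) (N + 1)) {g : V3 → ℝ} (hg : Continuous g)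
    {C : ℝ} (hC : ∀ v, |g v| ≤ C * (1 + ‖v‖ ^ 2)) {β : ℝ}
    (h : ∀ ε : ℝ, 0 < ε → ∃ τ : ℝ, 0 < τ ∧ ∃ N₀ : ℕ, ∀ N : ℕ, N₀ ≤ N →
      ∫⁻ z, ENNReal.ofReal (Real.exp (β * ∑ i : Fin (N + 1),
          (τ * ((N : ℝ) + 1) ^ (-(1 / 3 : ℝ)))⁻¹ *
            ∫ r in (0 : ℝ)..(τ * ((N : ℝ) + 1) ^ (-(1 / 3 : ℝ))), g (((Φ N).flow r z) i).2))
        ∂(localGibbsLaw σ (fun _ => a₀) (fun _ => 0) (fun _ => 1) N (Φ N)) ≤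
      ENNReal.ofReal (Real.exp (ε * ((N : ℝ) + 1))))
    {θ : ℝ} (hθ : 0 < θ) :
    β * ∫ v, g v ∂(gaussMeasure (0 : V3) θ) ≤ 3 / 2 * (θ - 1 - Real.log θ) := by
  by_contra hlt
  rw [not_le] at hlt
  set ε : ℝ := (β * ∫ v, g v ∂(gaussMeasure (0 : V3) θ) - 3 / 2 * (θ - 1 - Real.log θ)) / 2 with hεdef
  have hε : 0 < ε := by rw [hεdef]; linarith
  obtain ⟨τ, hτ, N₀, hN⟩ := h ε hε
  have hw : 0 < τ * ((N₀ : ℝ) + 1) ^ (-(1 / 3 : ℝ)) := mul_pos hτ (Real.rpow_pos_of_pos (by positivity) _)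
  have hfloor := shellFloor ha hσ2 N₀ (Φ N₀) hg hC β hθ hw
  have h2 := hfloor.trans (hN N₀ le_rfl)
  rw [ENNReal.ofReal_le_ofReal_iff (Real.exp_pos _).le, Real.exp_le_exp] at h2
  have hN1 : (0 : ℝ) < (N₀ : ℝ) + 1 := by positivity
  have : ((N₀ : ℝ) + 1) * (2 * ε) ≤ ε * ((N₀ : ℝ) + 1) := by
    have e2 : β * ∫ v, g v ∂(gaussMeasure (0 : V3) θ) - 3 / 2 * (θ - 1 - Real.log θ) = 2 * ε := by
      rw [hεdef]; ring
    rw [← e2]; exact h2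
  nlinarith


/-! ## -- Targets

No `disprover-wanted` target and no STUCK stub received (lead cycle 0). Pre-assessment of the registered stubs of
line `static-seed-doubling-rg` is in the module docstring, §(d). Nothing in this section is claimed. -/

/-! ## Near-misses / planned (cycle 2)

* momentum-shell floor (Galilean tilts, `β ∫g dN(γe₀, I) ≤ γ²/2`): same mechanism as (b.3) with `P` in place of `E`;
* `∃ τ` after `∀ ε` is load-bearing at `σ > 0` (free-flight fraction `e^{-cτσ²}`): needs a dynamical LOWER bound on the
  no-collision probability under the true flow — not attempted (no pathwise control of partner speeds in the tree). -/

end Summit.AtomisticToContinuum.HydrodynamicLimit.Cruxes.EquilibriumFastWindowLD.Disproof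

end
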